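import Literature.NumberTheory.Automorphic.HeckeAlgebra
import Literature.NumberTheory.Automorphic.GelfandPair
import Mathlib.FieldTheory.Perfect
import Mathlib.Algebra.CharP.Lemmas
import Mathlib.Algebra.BigOperators.Group.Finset.Preimage
import Mathlib.Algebra.BigOperators.Ring.Finset
import Mathlib.Data.Fintype.Powerset
import Mathlib.Data.Int.GCD
import HarnessLib

/-!
# The Brauer homomorphism and the normalized Brauer homomorphism (Treumann–Venkatesh)

Treumann–Venkatesh, *Functoriality, Smith theory, and the Brauer homomorphism*, Ann. of Math.
183 (2016), §4.1–4.3 (with the ring-theoretic Tate cohomology of §3.4) [TreumannVenkatesh2016].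
Setting: a group `G`, a subgroup `K`, an automorphism `σ` of `G` with `σ(K) = K` and `σ^p = 1`
for a prime `p`, and a commutative coefficient ring `k` (of characteristic `p` where it matters).
Everything is carried out for the tree's model `heckeAlgebra k G K = End_G(k[G ⧸ K])` of the
Hecke algebra (`HeckeAlgebra.lean`), over an abstract group: no topology or measure is needed
for §4.1–4.3 (loc. cit. has `G` locally profinite and `K` compact open, which only serves to make
`(G, K)` a Hecke pair).

## Dictionary with loc. cit. §2.10

Treumann–Venkatesh write `ℋ(G, K) = Fun_G(G/K × G/K; k)`, the `G`-invariant functions `h(x, y)`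
on `G/K × G/K` supported on finitely many `G`-orbits, with product
`(h₁ ∗ h₂)(x, z) = ∑_y h₁(x, y) h₂(y, z)` (heckemult). For `T ∈ End_G(k[G ⧸ K])` we put
`heckeAlgebra.kernel T x y :=` the coefficient of `[x]` in `T [y]`; then `kernel` is `G`-invariant
(`kernel_smul_smul`), composition becomes (heckemult) on the nose (`kernel_mul`), `T` is
determined by its kernel (`ext_kernel`), and `h(K, gK) = kernel T [K] [gK]` is their function on
double cosets. (Their own identification `h ↦ (s ↦ ∑_t h(s, t) t)` is the transpose of this one,
an anti-isomorphism for (heckemult); all constructions below commute with transposition.)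

## Contents

* `heckeAlgebra.congr e he : ℋ(G, K) ≃ₐ[k] ℋ(G', K')` — transport of structure along a group
  isomorphism `e : G ≃* G'` with `e(K) = K'` (conjugation by `[gK] ↦ [e(g)K']`); for `e = σ` this
  is the `σ`-action `h ↦ h^σ`, `h^σ(x^σ) = h(x)` of §4.2 (`kernel_congr_apply`), and
  `heckeAlgebra.fixedSubalgebra` is `ℋ(G, K)^σ`.
* `heckeAlgebra.mapCoeffs τ : ℋ(G, K) ≃+* ℋ(G, K)` — change of coefficients along a ring
  automorphism `τ` of `k` (`τ` entrywise on kernels; `τ`-semilinear): the `𝔽_p`-structure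
  `ℋ = Fun_G(…; 𝔽_p) ⊗ k` of §4.3 is used only through `τ = Frob⁻¹`.
* `heckeAlgebra.restrict K H : ℋ(G, K) →ₗ[k] ℋ(H, K ∩ H)` — restriction of kernels along
  `ι : H/(K ∩ H) ↪ G/K` for a subgroup `H`.
* `fixedSubgroup σ = G^σ`; `IsCosetPlain K σ` = condition (a) of §4.1 (`G^σ/K^σ → (G/K)^σ`
  bijective), `IsVirtuallyPrimeTo K p` = condition (b), `IsPlain K σ p` = both = "`σ`-plain".
* `heckeAlgebra.brauerHom K σ = restrict K (G^σ) : ℋ(G, K) →ₗ[k] ℋ(G^σ, K^σ)` — **the Brauer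
  homomorphism** `Br` of §4.2 (restriction of kernels to `G^σ/K^σ × G^σ/K^σ`), with
  `brauerHom_mul`: multiplicative on `ℋ(G, K)^σ` when `p = char k` and (a) holds (the claim of
  §4.2, proved via `sum_eq_zero_of_perm_invariant`: free `σ̄`-orbits in `G/K` have size `p`),
  packaged as `heckeAlgebra.brauerAlgHom : ℋ(G, K)^σ →ₐ[k] ℋ(G^σ, K^σ)`;
  `brauerHom_sum_pow_congr`: `Br` kills traces `∑_{i<p} h^{σ^i}` (so factors through the Tate
  ring `Ĥ⁰ = ℋ^σ/Nℋ`, §3.4).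
* `cyclicNorm θ p a = a · θ a ⋯ θ^{p-1} a` — the norm map of §3.4 with its ring-homomorphism
  properties into `Ĥ⁰` for commutative `A` (`cyclicNorm_mul`, `cyclicNorm_smul`, `apply_cyclicNorm`,
  `cyclicNorm_add`: additive modulo traces).
* `heckeAlgebra.frobeniusBrauerHom = Br ∘ cyclicNorm` — the Frobenius-semilinear extension `B̃r` of
  `Br^p` (§4.3, via §3.4), and `heckeAlgebra.normalizedBrauerHom = mapCoeffs Frob⁻¹ ∘ B̃r` — **the
  normalized Brauer homomorphism** `NBr` of §4.3, with the explicit formula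
  `kernel_normalizedBrauerHom` and, under `IsGelfandPair k G K` (commutativity), `σ^p = 1`,
  `CharP k p`, `PerfectRing k p` and (a), the `k`-algebra homomorphism
  `heckeAlgebra.normalizedBrauerAlgHom : ℋ(G, K) →ₐ[k] ℋ(G^σ, K^σ)`.

## Remarks on faithfulness

* §4.3 defines `NBr` as "the unique `k`-linear homomorphism agreeing with `B̃r` on
  `Fun_G(G/K × G/K; 𝔽_p)`", `B̃r` being the extension `h ↦ Br(h h^σ ⋯ h^{σ^{p-1}})` of `Br^p`
  provided by §3.4; this is what `normalizedBrauerHom` implements (`id ⊗ Frob⁻¹` after `B̃r`), and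
  it yields `NBr(h)(x, y) = ((h h^σ ⋯ h^{σ^{p-1}})(ι x, ι y))^{1/p}`. The printed explicit formula
  (4.3), `NBr(h)(K^σ, gK^σ) = ((h^{∗p})(K, gK))^{1/p}`, coincides with this for `σ`-invariant `h`
  (`kernel_normalizedBrauerHom_of_congr_eq`) — the case of the applications in loc. cit. §8 — but
  not for general `h` (for `G = ℤ`, `K = 1`, `σ = -1`, `p = 2`, `h = [1] ∈ k[ℤ]`: `NBr(h) = 1`, the
  value of the augmentation, whereas `((h ∗ h)(0, 0))^{1/2} = 0`); we follow the definition.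
* Loc. cit. assumes for `NBr` that `ℋ(G, K)` and `ℋ(G^σ, K^σ)` are commutative integral domains;
  integrality is used there only for the *uniqueness* of `B̃r`/`NBr`, so the construction and its
  homomorphism property are recorded under commutativity of `ℋ(G, K)` alone.
* Condition (b) of `σ`-plainness and the topology enter only the Smith-theoretic Theorem of §4.3
  and the Tate-cohomology compatibility (Brauercompat) of §4.2/§6.1, which are NOT formalised
  here (they concern `ℋ`-modules `H^*(X/K)`, resp. representations, not the Hecke algebra).

## References

* D. Treumann, A. Venkatesh, *Functoriality, Smith theory, and the Brauer homomorphism*,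
  Ann. of Math. (2) 183 (2016), 177–228, §2.10, §3.4, §4.1–4.3 [TreumannVenkatesh2016]
  (arXiv:1407.2346, pp. 8, 10–13).
-/

open MonoidAlgebra Representation

noncomputable section

namespace Literature.NumberTheory.Automorphic

variable {k G : Type*} [CommRing k] [Group G] {K : Subgroup G}

namespace heckeAlgebra

/-! ### Matrix coefficients (kernels) of Hecke operators -/

section Kernel

/-- The **kernel** (matrix coefficient) of a Hecke operator `T ∈ ℋ(G, K) = End_G(k[G ⧸ K])`:
`kernel T x y` is the coefficient of `[x]` in `T [y]`, so that `T [y] = ∑ₓ kernel T x y • [x]`.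
It is a `G`-invariant function on `G ⧸ K × G ⧸ K` supported on finitely many `G`-orbits, i.e.
an element of Treumann–Venkatesh's `Fun_G(G/K × G/K; k)`, and `T ↦ kernel T` is an algebra
isomorphism onto
`Fun_G` with the product `(h₁ ∗ h₂)(x, z) = ∑_y h₁(x, y) h₂(y, z)` (`kernel_mul`)
(Treumann–Venkatesh 2016, §2.10, eq. (heckemult)). [cite: TreumannVenkatesh2016, §2.10] -/
def kernel (T : heckeAlgebra k G K) (x y : G ⧸ K) : k :=
  ((T : Module.End k (MonoidAlgebra k (G ⧸ K))) (single y 1)).coeff x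

/-- Unfolding of `kernel`. [folklore] -/
theorem kernel_def (T : heckeAlgebra k G K) (x y : G ⧸ K) :
    kernel T x y = ((T : Module.End k (MonoidAlgebra k (G ⧸ K))) (single y 1)).coeff x :=
  rfl

/-- `kernel` is additive in the operator. [folklore] -/
@[simp] theorem kernel_add (S T : heckeAlgebra k G K) (x y : G ⧸ K) :
    kernel (S + T) x y = kernel S x y + kernel T x y :=
  rfl

/-- `kernel` is homogeneous in the operator. [folklore] -/
@[simp] theorem kernel_smul (c : k) (T : heckeAlgebra k G K) (x y : G ⧸ K) :
    kernel (c • T) x y = c * kernel T x y :=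
  rfl

/-- The zero operator has zero kernel. [folklore] -/
@[simp] theorem kernel_zero (x y : G ⧸ K) : kernel (0 : heckeAlgebra k G K) x y = 0 :=
  rfl

/-- The kernel of a finite sum of operators. [folklore] -/
theorem kernel_sum {ι : Type*} (s : Finset ι) (T : ι → heckeAlgebra k G K) (x y : G ⧸ K) :
    kernel (∑ i ∈ s, T i) x y = ∑ i ∈ s, kernel (T i) x y := by
  classical
  induction s using Finset.induction_on with
  | empty => simp
  | insert i s hi ih => rw [Finset.sum_insert hi, Finset.sum_insert hi, kernel_add, ih]

/-- The identity has kernel `δ_{x, y}`. [folklore] -/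
theorem kernel_one [DecidableEq (G ⧸ K)] (x y : G ⧸ K) :
    kernel (1 : heckeAlgebra k G K) x y = if y = x then 1 else 0 := by
  rw [kernel_def, OneMemClass.coe_one, Module.End.one_apply, coeff_single, Finsupp.single_apply]

/-- **`G`-invariance of the kernel**: `kernel T (g • x) (g • y) = kernel T x y`, i.e. the kernel is
a function on the `G`-orbits of `G ⧸ K × G ⧸ K`, which are the double cosets `K\G/K`
(Treumann–Venkatesh 2016, §2.10). [folklore] -/
theorem kernel_smul_smul (T : heckeAlgebra k G K) (g : G) (x y : G ⧸ K) :
    kernel T (g • x) (g • y) = kernel T x y :=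
  coeff_apply_single_smul T.2 g x y

/-- **Product formula** `kernel (S T) x z = ∑_y kernel S x y · kernel T y z` (a finite sum), i.e.
composition in `End_G(k[G ⧸ K])` is the product (heckemult) of Treumann–Venkatesh 2016, §2.10.
[cite: TreumannVenkatesh2016, §2.10] -/
theorem kernel_mul (S T : heckeAlgebra k G K) (x z : G ⧸ K) :
    kernel (S * T) x z = ∑ᶠ y, kernel S x y * kernel T y z := by
  rw [show kernel (S * T) x z = ((S : Module.End k (MonoidAlgebra k (G ⧸ K)))
      ((T : Module.End k (MonoidAlgebra k (G ⧸ K))) (single z 1))).coeff x from rfl,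
    coeff_apply_eq_finsum]
  exact finsum_congr fun y => mul_comm _ _

/-- For fixed `y`, `x ↦ kernel T x y` is finitely supported (`T [y]` is a finite sum). [folklore] -/
theorem finite_support_kernel (T : heckeAlgebra k G K) (y : G ⧸ K) :
    (Function.support fun x => kernel T x y).Finite :=
  ((T : Module.End k (MonoidAlgebra k (G ⧸ K))) (single y 1)).coeff.hasFiniteSupport

/-- A left coset is the translate of the trivial coset by its chosen representative. [folklore] -/
theorem out_smul_coe_one (y : G ⧸ K) : y.out • ((1 : G) : G ⧸ K) = y := by
  rw [MulAction.Quotient.smul_coe, smul_eq_mul, mul_one, QuotientGroup.out_eq']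

/-- Every kernel entry is an entry in the column of the trivial coset:
`kernel T x y = kernel T (ỹ⁻¹ • x) [K]` for the chosen representative `ỹ` of `y`. [folklore] -/
theorem kernel_eq_kernel_one (T : heckeAlgebra k G K) (x y : G ⧸ K) :
    kernel T x y = kernel T (y.out⁻¹ • x) ((1 : G) : G ⧸ K) := by
  conv_lhs => rw [← out_smul_coe_one y, ← smul_inv_smul y.out x]
  exact kernel_smul_smul T _ _ _

/-- **Extensionality**: a Hecke operator is determined by the column `kernel T · [K]` of its
kernel, i.e. by `T [K]` (Frobenius reciprocity). [folklore] -/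
theorem ext_kernel {S T : heckeAlgebra k G K}
    (h : ∀ x, kernel S x ((1 : G) : G ⧸ K) = kernel T x ((1 : G) : G ⧸ K)) : S = T := by
  have h1 : (S : Module.End k (MonoidAlgebra k (G ⧸ K))) (single ((1 : G) : G ⧸ K) 1) =
      (T : Module.End k (MonoidAlgebra k (G ⧸ K))) (single ((1 : G) : G ⧸ K) 1) :=
    MonoidAlgebra.ext (Finsupp.ext h)
  refine Subtype.ext (MonoidAlgebra.lhom_ext' fun q => LinearMap.ext_ring ?_)
  simp only [LinearMap.comp_apply, lsingle_apply]
  rw [single_eq_ofMulAction_out K q, apply_ofMulAction_apply, apply_ofMulAction_apply, h1]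

/-- Two Hecke operators with the same kernel are equal. [folklore] -/
theorem ext_kernel' {S T : heckeAlgebra k G K} (h : ∀ x y, kernel S x y = kernel T x y) : S = T :=
  ext_kernel fun x => h x _

end Kernel

/-! ### Conjugation by semilinear isomorphisms of the permutation module -/

section Semiconj

variable {X Y : Type*}

/-- Conjugation `T ↦ Φ ∘ T ∘ Φ⁻¹` of `k`-linear endomorphisms of `k[X]` by an additive isomorphism
`Φ : k[X] ≃ k[Y]` that is semilinear along a ring automorphism `τ` of `k`; the result is again
`k`-linear. Used twice below: for `Φ` the transport along a bijection `X ≃ Y` (`τ = 1`) and for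
`Φ` the change of coefficients along `τ` (`X = Y`). [folklore] -/
def semiconj (Φ : MonoidAlgebra k X ≃+ MonoidAlgebra k Y) (τ : k ≃+* k)
    (hΦ : ∀ (c : k) (v : MonoidAlgebra k X), Φ (c • v) = τ c • Φ v)
    (T : Module.End k (MonoidAlgebra k X)) : Module.End k (MonoidAlgebra k Y) where
  toFun w := Φ (T (Φ.symm w))
  map_add' w₁ w₂ := by simp only [map_add]
  map_smul' c w := by
    have h : Φ.symm (c • w) = τ.symm c • Φ.symm w :=
      Φ.injective (by rw [hΦ, Φ.apply_symm_apply, Φ.apply_symm_apply, RingEquiv.apply_symm_apply])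
    rw [h, map_smul, hΦ, RingEquiv.apply_symm_apply, RingHom.id_apply]

variable (Φ : MonoidAlgebra k X ≃+ MonoidAlgebra k Y) (τ : k ≃+* k)
  (hΦ : ∀ (c : k) (v : MonoidAlgebra k X), Φ (c • v) = τ c • Φ v)

/-- Unfolding of `semiconj`. [folklore] -/
theorem semiconj_apply (T : Module.End k (MonoidAlgebra k X)) (w : MonoidAlgebra k Y) :
    semiconj Φ τ hΦ T w = Φ (T (Φ.symm w)) :=
  rfl

include hΦ in
/-- The inverse of a `τ`-semilinear isomorphism is `τ⁻¹`-semilinear. [folklore] -/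
theorem addEquiv_symm_smul (c : k) (w : MonoidAlgebra k Y) : Φ.symm (c • w) = τ.symm c • Φ.symm w :=
  Φ.injective (by rw [hΦ, Φ.apply_symm_apply, Φ.apply_symm_apply, RingEquiv.apply_symm_apply])

/-- `semiconj` is unital. [folklore] -/
theorem semiconj_one : semiconj Φ τ hΦ 1 = 1 :=
  LinearMap.ext fun w => by simp [semiconj_apply]

/-- `semiconj` is multiplicative. [folklore] -/
theorem semiconj_mul (S T : Module.End k (MonoidAlgebra k X)) :
    semiconj Φ τ hΦ (S * T) = semiconj Φ τ hΦ S * semiconj Φ τ hΦ T :=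
  LinearMap.ext fun w => by simp [semiconj_apply]

/-- `semiconj` is additive. [folklore] -/
theorem semiconj_add (S T : Module.End k (MonoidAlgebra k X)) :
    semiconj Φ τ hΦ (S + T) = semiconj Φ τ hΦ S + semiconj Φ τ hΦ T :=
  LinearMap.ext fun w => by simp [semiconj_apply]

/-- `semiconj` is `τ`-semilinear. [folklore] -/
theorem semiconj_smul (c : k) (T : Module.End k (MonoidAlgebra k X)) :
    semiconj Φ τ hΦ (c • T) = τ c • semiconj Φ τ hΦ T :=
  LinearMap.ext fun w => by simp [semiconj_apply, hΦ]

/-- Conjugating back by `Φ⁻¹` undoes `semiconj Φ`. [folklore] -/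
theorem semiconj_symm_semiconj (T : Module.End k (MonoidAlgebra k X)) :
    semiconj Φ.symm τ.symm (addEquiv_symm_smul Φ τ hΦ) (semiconj Φ τ hΦ T) = T :=
  LinearMap.ext fun w => by simp [semiconj_apply]

/-- Conjugating by `Φ` undoes `semiconj Φ⁻¹`. [folklore] -/
theorem semiconj_semiconj_symm (T : Module.End k (MonoidAlgebra k Y)) :
    semiconj Φ τ hΦ (semiconj Φ.symm τ.symm (addEquiv_symm_smul Φ τ hΦ) T) = T :=
  LinearMap.ext fun w => by simp [semiconj_apply]

/-- **Equivariant conjugation preserves Hecke algebras.** If `Φ : k[G ⧸ K] ≃ k[G' ⧸ K']`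
intertwines the permutation representation of `G` with that of `G'` along a group isomorphism
`e : G ≃ G'`, then `Φ ∘ T ∘ Φ⁻¹` is `G'`-equivariant whenever `T` is `G`-equivariant. [folklore] -/
theorem semiconj_mem {G' : Type*} [Group G'] {K' : Subgroup G'}
    {Φ : MonoidAlgebra k (G ⧸ K) ≃+ MonoidAlgebra k (G' ⧸ K')} {τ : k ≃+* k}
    {hΦ : ∀ (c : k) (v : MonoidAlgebra k (G ⧸ K)), Φ (c • v) = τ c • Φ v} (e : G ≃* G')
    (hρ : ∀ (g : G) (v : MonoidAlgebra k (G ⧸ K)),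
      Φ (ofMulAction k G (G ⧸ K) g v) = ofMulAction k G' (G' ⧸ K') (e g) (Φ v))
    {T : Module.End k (MonoidAlgebra k (G ⧸ K))} (hT : T ∈ heckeAlgebra k G K) :
    semiconj Φ τ hΦ T ∈ heckeAlgebra k G' K' := by
  rw [mem_heckeAlgebra_iff] at hT ⊢
  intro g'
  obtain ⟨g, rfl⟩ := e.surjective g'
  refine LinearMap.ext fun w => ?_
  have h1 : Φ.symm (ofMulAction k G' (G' ⧸ K') (e g) w) = ofMulAction k G (G ⧸ K) g (Φ.symm w) :=
    Φ.injective (by rw [Φ.apply_symm_apply, hρ, Φ.apply_symm_apply])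
  simp only [Module.End.mul_apply, semiconj_apply]
  rw [h1, ← hρ]
  exact congrArg Φ (LinearMap.congr_fun (hT g) (Φ.symm w))

end Semiconj

/-! ### Transport of structure along group isomorphisms; the `σ`-action -/

section Congr

variable {G' : Type*} [Group G'] {K' : Subgroup G'}

variable (K K') in
/-- The bijection `G ⧸ K ≃ G' ⧸ K'`, `gK ↦ e(g)K'`, induced by a group isomorphism `e` with
`e(K) = K'`. [folklore] -/
def quotientEquiv (e : G ≃* G') (he : ∀ x, e x ∈ K' ↔ x ∈ K) : G ⧸ K ≃ G' ⧸ K' :=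
  Quotient.congr e.toEquiv fun a b => by
    rw [QuotientGroup.leftRel_apply, QuotientGroup.leftRel_apply]
    change _ ↔ (e a)⁻¹ * e b ∈ K'
    rw [← map_inv, ← map_mul, he]

variable (e : G ≃* G') (he : ∀ x, e x ∈ K' ↔ x ∈ K)

/-- `quotientEquiv` on a coset. [folklore] -/
@[simp] theorem quotientEquiv_mk (g : G) :
    quotientEquiv K K' e he (g : G ⧸ K) = ((e g : G') : G' ⧸ K') :=
  rfl

/-- The inverse of `quotientEquiv` on a coset. [folklore] -/
@[simp] theorem quotientEquiv_symm_mk (g' : G') :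
    (quotientEquiv K K' e he).symm (g' : G' ⧸ K') = ((e.symm g' : G) : G ⧸ K) :=
  rfl

/-- `quotientEquiv` is `e`-equivariant. [folklore] -/
theorem quotientEquiv_smul (g : G) (x : G ⧸ K) :
    quotientEquiv K K' e he (g • x) = e g • quotientEquiv K K' e he x := by
  induction x using QuotientGroup.induction_on with
  | H a => simp only [MulAction.Quotient.smul_coe, smul_eq_mul, quotientEquiv_mk, map_mul]

/-- The inverse of `quotientEquiv` is `e⁻¹`-equivariant. [folklore] -/
theorem quotientEquiv_symm_smul (g' : G') (x' : G' ⧸ K') :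
    (quotientEquiv K K' e he).symm (g' • x') = e.symm g' • (quotientEquiv K K' e he).symm x' := by
  induction x' using QuotientGroup.induction_on with
  | H a => simp only [MulAction.Quotient.smul_coe, smul_eq_mul, quotientEquiv_symm_mk, map_mul]

variable (K K') in
/-- The `k`-linear isomorphism `k[G ⧸ K] ≃ k[G' ⧸ K']`, `[gK] ↦ [e(g)K']`, induced by `e`.
[folklore] -/
noncomputable def congrDomain : MonoidAlgebra k (G ⧸ K) ≃ₗ[k] MonoidAlgebra k (G' ⧸ K') :=
  mapDomainLinearEquiv k k (quotientEquiv K K' e he)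

/-- `congrDomain` on a basis vector. [folklore] -/
@[simp] theorem congrDomain_single (x : G ⧸ K) (c : k) :
    congrDomain K K' e he (single x c) = single (quotientEquiv K K' e he x) c :=
  mapDomainLinearEquiv_single _ _ _

/-- The inverse of `congrDomain` on a basis vector. [folklore] -/
@[simp] theorem congrDomain_symm_single (x' : G' ⧸ K') (c : k) :
    (congrDomain K K' e he).symm (single x' c) = single ((quotientEquiv K K' e he).symm x') c := by
  rw [congrDomain, symm_mapDomainLinearEquiv, mapDomainLinearEquiv_single]

/-- Coefficients of `congrDomain v`. [folklore] -/
@[simp] theorem coeff_congrDomain_apply (v : MonoidAlgebra k (G ⧸ K)) (x' : G' ⧸ K') :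
    ((congrDomain K K' e he : _ ≃ₗ[k] _) v).coeff x' =
      v.coeff ((quotientEquiv K K' e he).symm x') := by
  rw [congrDomain, coeff_mapDomainLinearEquiv, Finsupp.equivMapDomain_apply]

/-- `congrDomain` intertwines the permutation representations along `e`. [folklore] -/
theorem congrDomain_ofMulAction (g : G) (v : MonoidAlgebra k (G ⧸ K)) :
    (congrDomain K K' e he).toAddEquiv (ofMulAction k G (G ⧸ K) g v) =
      ofMulAction k G' (G' ⧸ K') (e g) ((congrDomain K K' e he).toAddEquiv v) := by
  refine MonoidAlgebra.ext (Finsupp.ext fun x' => ?_)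
  change ((congrDomain K K' e he : _ ≃ₗ[k] _) _).coeff x' =
    (ofMulAction k G' (G' ⧸ K') (e g) ((congrDomain K K' e he : _ ≃ₗ[k] _) v)).coeff x'
  rw [coeff_congrDomain_apply, coeff_ofMulAction, coeff_ofMulAction, coeff_congrDomain_apply,
    quotientEquiv_symm_smul, map_inv, MulEquiv.symm_apply_apply]

/-- `congrDomain` is `k`-linear (in the form consumed by `semiconj`). [folklore] -/
theorem congrDomain_smul' (c : k) (v : MonoidAlgebra k (G ⧸ K)) :
    (congrDomain K K' e he).toAddEquiv (c • v) =
      RingEquiv.refl k c • (congrDomain K K' e he).toAddEquiv v :=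
  map_smul (congrDomain K K' e he) c v

/-- The symmetric form of `congrDomain_smul'`. [folklore] -/
theorem congrDomain_symm_smul' (c : k) (w : MonoidAlgebra k (G' ⧸ K')) :
    (congrDomain K K' e he).symm.toAddEquiv (c • w) =
      RingEquiv.refl k c • (congrDomain K K' e he).symm.toAddEquiv w :=
  map_smul (congrDomain K K' e he).symm c w

/-- Coefficients of `congrDomain⁻¹ w`. [folklore] -/
@[simp] theorem coeff_congrDomain_symm_apply (w : MonoidAlgebra k (G' ⧸ K')) (x : G ⧸ K) :
    ((congrDomain K K' e he).symm w).coeff x = w.coeff (quotientEquiv K K' e he x) := by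
  rw [congrDomain, symm_mapDomainLinearEquiv, coeff_mapDomainLinearEquiv,
    Finsupp.equivMapDomain_apply, Equiv.symm_symm]

/-- The inverse of `congrDomain` intertwines the permutation representations along `e⁻¹`.
[folklore] -/
theorem congrDomain_symm_ofMulAction (g' : G') (w : MonoidAlgebra k (G' ⧸ K')) :
    (congrDomain K K' e he).symm.toAddEquiv (ofMulAction k G' (G' ⧸ K') g' w) =
      ofMulAction k G (G ⧸ K) (e.symm g') ((congrDomain K K' e he).symm.toAddEquiv w) := by
  refine MonoidAlgebra.ext (Finsupp.ext fun x => ?_)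
  change ((congrDomain K K' e he).symm _).coeff x =
    (ofMulAction k G (G ⧸ K) (e.symm g') ((congrDomain K K' e he).symm w)).coeff x
  rw [coeff_congrDomain_symm_apply, coeff_ofMulAction, coeff_ofMulAction,
    coeff_congrDomain_symm_apply, quotientEquiv_smul, map_inv, MulEquiv.apply_symm_apply]

variable (K K') in
/-- The transported operator `Φ ∘ T ∘ Φ⁻¹`, `Φ = congrDomain` (the function underlying `congr`).
[folklore] -/
def congrFun (T : heckeAlgebra k G K) : heckeAlgebra k G' K' :=
  ⟨semiconj (congrDomain K K' e he).toAddEquiv (RingEquiv.refl k) (congrDomain_smul' e he) T.1,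
    semiconj_mem e (congrDomain_ofMulAction e he) T.2⟩

variable (K K') in
/-- The inverse transport `Φ⁻¹ ∘ T' ∘ Φ` (the inverse function underlying `congr`). [folklore] -/
def congrInv (T' : heckeAlgebra k G' K') : heckeAlgebra k G K :=
  ⟨semiconj (congrDomain K K' e he).symm.toAddEquiv (RingEquiv.refl k)
      (congrDomain_symm_smul' e he) T'.1,
    semiconj_mem e.symm (congrDomain_symm_ofMulAction e he) T'.2⟩

/-- Unfolding of `congrFun` on vectors: `congrFun T w = Φ (T (Φ⁻¹ w))`. [folklore] -/
theorem congrFun_apply_apply (T : heckeAlgebra k G K) (w : MonoidAlgebra k (G' ⧸ K')) :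
    (congrFun K K' e he T : Module.End k (MonoidAlgebra k (G' ⧸ K'))) w =
      congrDomain K K' e he ((T : Module.End k (MonoidAlgebra k (G ⧸ K)))
        ((congrDomain K K' e he).symm w)) :=
  rfl

/-- Unfolding of `congrInv` on vectors: `congrInv T' v = Φ⁻¹ (T' (Φ v))`. [folklore] -/
theorem congrInv_apply_apply (T' : heckeAlgebra k G' K') (v : MonoidAlgebra k (G ⧸ K)) :
    (congrInv K K' e he T' : Module.End k (MonoidAlgebra k (G ⧸ K))) v =
      (congrDomain K K' e he).symm ((T' : Module.End k (MonoidAlgebra k (G' ⧸ K')))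
        (congrDomain K K' e he v)) :=
  rfl

variable (K K') in
/-- **Transport of structure** `ℋ(G, K) ≃ₐ[k] ℋ(G', K')` along a group isomorphism `e : G ≃ G'`
with `e(K) = K'`: conjugation `T ↦ Φ ∘ T ∘ Φ⁻¹` by `Φ = congrDomain : [gK] ↦ [e(g)K']`. On kernels,
`kernel (congr T) (e x) (e y) = kernel T x y` (`kernel_congr_apply`). For `G' = G`, `K' = K` and
`e = σ` an automorphism of `G` with `σ(K) = K` this is the `σ`-action `h ↦ h^σ`,
`h^σ(x^σ) = h(x)`, on `ℋ(G, K)` of Treumann–Venkatesh 2016, §4.2. [cite: TreumannVenkatesh2016,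
§4.2] -/
def congr : heckeAlgebra k G K ≃ₐ[k] heckeAlgebra k G' K' where
  toFun := congrFun K K' e he
  invFun := congrInv K K' e he
  left_inv T := Subtype.ext (LinearMap.ext fun v => by
    rw [congrInv_apply_apply, congrFun_apply_apply, LinearEquiv.symm_apply_apply,
      LinearEquiv.symm_apply_apply])
  right_inv T' := Subtype.ext (LinearMap.ext fun w => by
    rw [congrFun_apply_apply, congrInv_apply_apply, LinearEquiv.apply_symm_apply,
      LinearEquiv.apply_symm_apply])
  map_mul' S T := Subtype.ext (semiconj_mul (congrDomain K K' e he).toAddEquiv (RingEquiv.refl k)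
    (congrDomain_smul' e he) S.1 T.1)
  map_add' S T := Subtype.ext (semiconj_add (congrDomain K K' e he).toAddEquiv (RingEquiv.refl k)
    (congrDomain_smul' e he) S.1 T.1)
  commutes' c := Subtype.ext (LinearMap.ext fun w => by
    change congrDomain K K' e he ((algebraMap k (heckeAlgebra k G K) c :
        Module.End k (MonoidAlgebra k (G ⧸ K))) ((congrDomain K K' e he).symm w)) =
      (algebraMap k (heckeAlgebra k G' K') c : Module.End k (MonoidAlgebra k (G' ⧸ K'))) w
    rw [Subalgebra.coe_algebraMap, Subalgebra.coe_algebraMap, Module.algebraMap_end_apply,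
      Module.algebraMap_end_apply, map_smul, LinearEquiv.apply_symm_apply])

/-- `congr` is `congrFun` as a function. [folklore] -/
theorem congr_apply (T : heckeAlgebra k G K) : congr K K' e he T = congrFun K K' e he T :=
  rfl

/-- The inverse of `congr` is `congrInv` as a function. [folklore] -/
theorem congr_symm_apply (T' : heckeAlgebra k G' K') :
    (congr K K' e he).symm T' = congrInv K K' e he T' :=
  rfl

/-- Unfolding of `congr` on vectors: `congr T w = Φ (T (Φ⁻¹ w))`. [folklore] -/
theorem congr_apply_apply (T : heckeAlgebra k G K) (w : MonoidAlgebra k (G' ⧸ K')) :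
    (congr K K' e he T : Module.End k (MonoidAlgebra k (G' ⧸ K'))) w =
      congrDomain K K' e he ((T : Module.End k (MonoidAlgebra k (G ⧸ K)))
        ((congrDomain K K' e he).symm w)) :=
  rfl

/-- **Kernel of the transported operator**: `kernel (congr T) x' y' = kernel T (e⁻¹ x') (e⁻¹ y')`.
[folklore] -/
theorem kernel_congr (T : heckeAlgebra k G K) (x' y' : G' ⧸ K') :
    kernel (congr K K' e he T) x' y' =
      kernel T ((quotientEquiv K K' e he).symm x') ((quotientEquiv K K' e he).symm y') := by
  rw [kernel_def, congr_apply_apply, congrDomain_symm_single, coeff_congrDomain_apply, kernel_def]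

/-- `kernel (congr T) (e x) (e y) = kernel T x y`: Treumann–Venkatesh's `h^σ(x^σ) = h(x)`
(2016, §4.2). [cite: TreumannVenkatesh2016, §4.2] -/
theorem kernel_congr_apply (T : heckeAlgebra k G K) (x y : G ⧸ K) :
    kernel (congr K K' e he T) (quotientEquiv K K' e he x) (quotientEquiv K K' e he y) =
      kernel T x y := by
  rw [kernel_congr, Equiv.symm_apply_apply, Equiv.symm_apply_apply]

end Congr

/-! ### Change of coefficients along a ring automorphism -/

section MapCoeffs

variable (τ : k ≃+* k)

variable (K) in
/-- Coefficientwise application of a ring automorphism `τ` of `k`: the additive automorphism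
`τ_* : k[G ⧸ K] ≃ k[G ⧸ K]`, `∑ c_x [x] ↦ ∑ τ(c_x) [x]`. [folklore] -/
def mapRangeEquiv : MonoidAlgebra k (G ⧸ K) ≃+ MonoidAlgebra k (G ⧸ K) :=
  coeffAddEquiv.trans ((Finsupp.mapRange.addEquiv τ.toAddEquiv).trans coeffAddEquiv.symm)

/-- Coefficients of `mapRangeEquiv τ v`. [folklore] -/
@[simp] theorem coeff_mapRangeEquiv_apply (v : MonoidAlgebra k (G ⧸ K)) (x : G ⧸ K) :
    (mapRangeEquiv K τ v).coeff x = τ (v.coeff x) :=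
  rfl

/-- The inverse of `mapRangeEquiv τ` is `mapRangeEquiv τ⁻¹`. [folklore] -/
theorem mapRangeEquiv_symm : (mapRangeEquiv K τ).symm = mapRangeEquiv K τ.symm :=
  rfl

/-- `mapRangeEquiv τ` on a basis vector. [folklore] -/
@[simp] theorem mapRangeEquiv_single (x : G ⧸ K) (c : k) :
    mapRangeEquiv K τ (single x c) = single x (τ c) := by
  classical
  refine MonoidAlgebra.ext (Finsupp.ext fun y => ?_)
  rw [coeff_mapRangeEquiv_apply, coeff_single, coeff_single, Finsupp.single_apply,
    Finsupp.single_apply]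
  split_ifs <;> simp

/-- `mapRangeEquiv τ` is `τ`-semilinear. [folklore] -/
theorem mapRangeEquiv_smul' (c : k) (v : MonoidAlgebra k (G ⧸ K)) :
    mapRangeEquiv K τ (c • v) = τ c • mapRangeEquiv K τ v := by
  refine MonoidAlgebra.ext (Finsupp.ext fun x => ?_)
  change τ ((c • v).coeff x) = (τ c • mapRangeEquiv K τ v).coeff x
  rw [coeff_smul, coeff_smul, Finsupp.coe_smul, Finsupp.coe_smul, Pi.smul_apply, Pi.smul_apply,
    smul_eq_mul, smul_eq_mul, map_mul]
  rfl

/-- `mapRangeEquiv τ` commutes with the permutation representation. [folklore] -/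
theorem mapRangeEquiv_ofMulAction (g : G) (v : MonoidAlgebra k (G ⧸ K)) :
    mapRangeEquiv K τ (ofMulAction k G (G ⧸ K) g v) =
      ofMulAction k G (G ⧸ K) (MulEquiv.refl G g) (mapRangeEquiv K τ v) := by
  refine MonoidAlgebra.ext (Finsupp.ext fun x => ?_)
  rw [MulEquiv.refl_apply, coeff_ofMulAction, coeff_mapRangeEquiv_apply,
    coeff_mapRangeEquiv_apply, coeff_ofMulAction]

variable (K) in
/-- The operator `τ_* ∘ T ∘ τ_*⁻¹` (the function underlying `mapCoeffs`). [folklore] -/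
def mapCoeffsFun (T : heckeAlgebra k G K) : heckeAlgebra k G K :=
  ⟨semiconj (mapRangeEquiv K τ) τ (mapRangeEquiv_smul' τ) T.1,
    semiconj_mem (MulEquiv.refl G) (mapRangeEquiv_ofMulAction τ) T.2⟩

/-- Unfolding of `mapCoeffsFun` on vectors. [folklore] -/
theorem mapCoeffsFun_apply_apply (T : heckeAlgebra k G K) (w : MonoidAlgebra k (G ⧸ K)) :
    (mapCoeffsFun K τ T : Module.End k (MonoidAlgebra k (G ⧸ K))) w =
      mapRangeEquiv K τ ((T : Module.End k (MonoidAlgebra k (G ⧸ K))) (mapRangeEquiv K τ.symm w)) :=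
  rfl

variable (K) in
/-- **Change of coefficients** along a ring automorphism `τ` of `k`: the ring automorphism
`T ↦ τ_* ∘ T ∘ τ_*⁻¹` of `ℋ(G, K) = End_G(k[G ⧸ K])`, where `τ_* = mapRangeEquiv τ` applies `τ` to
every coefficient; on kernels it is `τ` entrywise (`kernel_mapCoeffs`), i.e. it is `id ⊗ τ` for
the `𝔽_p`-structure `ℋ(G, K) = Fun_G(G/K × G/K; 𝔽_p) ⊗ k` of Treumann–Venkatesh 2016, §4.3. It is
`τ`-semilinear (`mapCoeffs_smul`), not `k`-linear unless `τ = 1`.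
[cite: TreumannVenkatesh2016, §4.3] -/
def mapCoeffs : heckeAlgebra k G K ≃+* heckeAlgebra k G K where
  toFun := mapCoeffsFun K τ
  invFun := mapCoeffsFun K τ.symm
  left_inv T := Subtype.ext (LinearMap.ext fun v => by
    rw [mapCoeffsFun_apply_apply, mapCoeffsFun_apply_apply, RingEquiv.symm_symm,
      ← mapRangeEquiv_symm, AddEquiv.symm_apply_apply, AddEquiv.symm_apply_apply])
  right_inv T := Subtype.ext (LinearMap.ext fun v => by
    rw [mapCoeffsFun_apply_apply, mapCoeffsFun_apply_apply, RingEquiv.symm_symm,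
      ← mapRangeEquiv_symm, AddEquiv.apply_symm_apply, AddEquiv.apply_symm_apply])
  map_mul' S T := Subtype.ext (semiconj_mul (mapRangeEquiv K τ) τ (mapRangeEquiv_smul' τ) S.1 T.1)
  map_add' S T := Subtype.ext (semiconj_add (mapRangeEquiv K τ) τ (mapRangeEquiv_smul' τ) S.1 T.1)

/-- `mapCoeffs` is `mapCoeffsFun` as a function. [folklore] -/
theorem mapCoeffs_apply (T : heckeAlgebra k G K) : mapCoeffs K τ T = mapCoeffsFun K τ T :=
  rfl

/-- The inverse of `mapCoeffs τ` is `mapCoeffs τ⁻¹`. [folklore] -/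
theorem mapCoeffs_symm_apply (T : heckeAlgebra k G K) :
    (mapCoeffs K τ).symm T = mapCoeffs K τ.symm T :=
  rfl

/-- `mapCoeffs τ` is `τ`-semilinear. [folklore] -/
theorem mapCoeffs_smul (c : k) (T : heckeAlgebra k G K) :
    mapCoeffs K τ (c • T) = τ c • mapCoeffs K τ T :=
  Subtype.ext (semiconj_smul (mapRangeEquiv K τ) τ (mapRangeEquiv_smul' τ) c T.1)

/-- **Kernel after change of coefficients**: `kernel (mapCoeffs τ T) x y = τ (kernel T x y)`.
[folklore] -/
theorem kernel_mapCoeffs (T : heckeAlgebra k G K) (x y : G ⧸ K) :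
    kernel (mapCoeffs K τ T) x y = τ (kernel T x y) := by
  rw [kernel_def, mapCoeffs_apply, mapCoeffsFun_apply_apply, coeff_mapRangeEquiv_apply,
    mapRangeEquiv_single, map_one, kernel_def]

end MapCoeffs

/-! ### Restriction of kernels to a subgroup -/

section Restrict

variable (K) (H : Subgroup G)

/-- The map `ι : H ⧸ (K ∩ H) → G ⧸ K`, `h(K ∩ H) ↦ hK`; it is injective and `H`-equivariant
(`quotientToQuotient_injective`, `quotientToQuotient_smul`). For `H = G^σ` this is the inclusion
`G^σ/K^σ ↪ (G/K)^σ ⊆ G/K` of Treumann–Venkatesh 2016, §4.1 (a). [folklore] -/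
def quotientToQuotient : H ⧸ K.subgroupOf H → G ⧸ K :=
  Quotient.map' (fun h : H => (h : G)) fun a b => by
    simp_rw [QuotientGroup.leftRel_eq]
    exact id

/-- `quotientToQuotient` on a coset. [folklore] -/
@[simp] theorem quotientToQuotient_mk (h : H) :
    quotientToQuotient K H (h : H ⧸ K.subgroupOf H) = ((h : G) : G ⧸ K) :=
  rfl

/-- `quotientToQuotient` is injective: `hK = h'K` with `h, h' ∈ H` forces `h⁻¹h' ∈ K ∩ H`.
[folklore] -/
theorem quotientToQuotient_injective : Function.Injective (quotientToQuotient K H) := by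
  intro x y
  induction x using QuotientGroup.induction_on with
  | H a =>
    induction y using QuotientGroup.induction_on with
    | H b =>
      rw [quotientToQuotient_mk, quotientToQuotient_mk, QuotientGroup.eq, QuotientGroup.eq]
      exact id

/-- `quotientToQuotient` is `H`-equivariant. [folklore] -/
theorem quotientToQuotient_smul (h : H) (x : H ⧸ K.subgroupOf H) :
    quotientToQuotient K H (h • x) = (h : G) • quotientToQuotient K H x := by
  induction x using QuotientGroup.induction_on with
  | H a => rfl

/-- The pulled-back vector `ι^*(T [K]) ∈ k[H ⧸ (K ∩ H)]`: coefficient of `[h(K ∩ H)]` = coefficient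
of `[hK]` in `T [K]`; finitely supported because `ι` is injective. [folklore] -/
noncomputable def restrictVector (T : heckeAlgebra k G K) : MonoidAlgebra k (H ⧸ K.subgroupOf H) :=
  comapDomain (quotientToQuotient K H) (quotientToQuotient_injective K H)
    ((T : Module.End k (MonoidAlgebra k (G ⧸ K))) (single ((1 : G) : G ⧸ K) 1))

/-- Coefficients of `restrictVector`. [folklore] -/
@[simp] theorem coeff_restrictVector_apply (T : heckeAlgebra k G K) (x : H ⧸ K.subgroupOf H) :
    (restrictVector K H T).coeff x = kernel T (quotientToQuotient K H x) ((1 : G) : G ⧸ K) := by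
  rw [restrictVector, coeff_comapDomain, Finsupp.comapDomain_apply, kernel_def]

/-- The column `kernel T · [K]` is `K`-invariant. [folklore] -/
theorem kernel_smul_one (T : heckeAlgebra k G K) {a : G} (ha : a ∈ K) (x : G ⧸ K) :
    kernel T (a • x) ((1 : G) : G ⧸ K) = kernel T x ((1 : G) : G ⧸ K) := by
  conv_lhs => rw [← smul_coe_one K ha]
  exact kernel_smul_smul T a x _

/-- `restrictVector T` is `(K ∩ H)`-invariant. [folklore] -/
theorem ofMulAction_restrictVector (T : heckeAlgebra k G K) (u : H) (hu : u ∈ K.subgroupOf H) :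
    ofMulAction k H (H ⧸ K.subgroupOf H) u (restrictVector K H T) = restrictVector K H T := by
  refine MonoidAlgebra.ext (Finsupp.ext fun x => ?_)
  rw [coeff_ofMulAction, coeff_restrictVector_apply, coeff_restrictVector_apply,
    quotientToQuotient_smul]
  exact kernel_smul_one K T (K.inv_mem (Subgroup.mem_subgroupOf.1 hu)) _

/-- The column of the trivial coset of the operator `extend K v` attached to a `K`-invariant vector
`v` is `v` itself. [folklore] -/
theorem kernel_one_of_coe_eq_extend {T : heckeAlgebra k G K} {v : MonoidAlgebra k (G ⧸ K)}
    (hv : ∀ a ∈ K, ofMulAction k G (G ⧸ K) a v = v)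
    (hT : (T : Module.End k (MonoidAlgebra k (G ⧸ K))) = extend K v) (x : G ⧸ K) :
    kernel T x ((1 : G) : G ⧸ K) = v.coeff x := by
  rw [kernel_def, hT]
  obtain ⟨a, ha⟩ := QuotientGroup.mk_out_eq_mul K (1 : G)
  rw [extend_single, one_smul, ha, one_mul, hv _ a.2]

/-- The restricted operator, as a bare function (see `restrict`). [folklore] -/
noncomputable def restrictFun (T : heckeAlgebra k G K) : heckeAlgebra k H (K.subgroupOf H) :=
  ⟨extend (K.subgroupOf H) (restrictVector K H T),
    extend_mem (K.subgroupOf H) fun u hu => ofMulAction_restrictVector K H T u hu⟩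

/-- The column of the trivial coset of `restrictFun T`. [folklore] -/
theorem kernel_restrictFun_one (T : heckeAlgebra k G K) (x : H ⧸ K.subgroupOf H) :
    kernel (restrictFun K H T) x ((1 : H) : H ⧸ K.subgroupOf H) =
      kernel T (quotientToQuotient K H x) ((1 : G) : G ⧸ K) := by
  rw [kernel_one_of_coe_eq_extend (K.subgroupOf H)
    (fun u hu => ofMulAction_restrictVector K H T u hu) rfl, coeff_restrictVector_apply]

/-- **Restriction of kernels** `ℋ(G, K) → ℋ(H, K ∩ H)`, `T ↦` the unique `H`-equivariant
endomorphism of `k[H ⧸ (K ∩ H)]` whose kernel is the restriction of the kernel of `T` along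
`ι × ι : (H/(K ∩ H))² ↪ (G/K)²` (`kernel_restrict`). A `k`-linear map, not multiplicative in
general; for `H = G^σ` it is the Brauer homomorphism of Treumann–Venkatesh 2016, §4.2
(`brauerHom`). [cite: TreumannVenkatesh2016, §4.2] -/
noncomputable def restrict : heckeAlgebra k G K →ₗ[k] heckeAlgebra k H (K.subgroupOf H) where
  toFun := restrictFun K H
  map_add' S T := ext_kernel fun x => by
    rw [kernel_add, kernel_restrictFun_one, kernel_restrictFun_one, kernel_restrictFun_one,
      kernel_add]
  map_smul' c T := ext_kernel fun x => by
    rw [RingHom.id_apply, kernel_smul, kernel_restrictFun_one, kernel_restrictFun_one, kernel_smul]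

/-- **Kernel of the restriction**: `kernel (restrict T) x y = kernel T (ι x) (ι y)`. [folklore] -/
theorem kernel_restrict (T : heckeAlgebra k G K) (x y : H ⧸ K.subgroupOf H) :
    kernel (restrict K H T) x y =
      kernel T (quotientToQuotient K H x) (quotientToQuotient K H y) := by
  change kernel (restrictFun K H T) x y = _
  rw [kernel_eq_kernel_one, kernel_restrictFun_one, quotientToQuotient_smul,
    kernel_eq_kernel_one T (quotientToQuotient K H x) (quotientToQuotient K H y)]
  -- both sides are `kernel T (g⁻¹ • ι x) [K]` for representatives `g` of `ι y` differing by `K`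
  have hy : quotientToQuotient K H y = ((y.out : G) : G ⧸ K) := by
    conv_lhs => rw [← QuotientGroup.out_eq' y]
    rfl
  obtain ⟨a, ha⟩ := QuotientGroup.mk_out_eq_mul K (y.out : G)
  rw [hy, ha, mul_inv_rev, mul_smul, kernel_smul_one K T (K.inv_mem a.2)]
  rfl

/-- Restriction is unital. [folklore] -/
theorem restrict_one : restrict K H (1 : heckeAlgebra k G K) = 1 := by
  classical
  refine ext_kernel' fun x y => ?_
  rw [kernel_restrict, kernel_one, kernel_one]
  simp only [(quotientToQuotient_injective K H).eq_iff]

end Restrict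


end heckeAlgebra

/-! ### Sums over the free orbits of a permutation of prime order

The elementary fact behind both "the Brauer map is an algebra homomorphism in characteristic `p`"
(Treumann–Venkatesh 2016, §4.2) and the additivity of the norm `a ↦ a a^σ ⋯ a^{σ^{p-1}}` modulo
traces (§3.4): a finite set stable under a permutation `e` of prime order `p` and free of fixed
points is a disjoint union of orbits `{y, e y, …, e^{p-1} y}` of exact size `p`. -/

section Orbits

/-- If `e^p = 1` for a prime `p` and `e y ≠ y`, then `i ↦ eⁱ y` is injective on `{0, …, p-1}`:
a non-trivial orbit of a permutation of prime order has exactly `p` points. [folklore] -/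
theorem injOn_pow_apply_range {α : Type*} {p : ℕ} (hp : p.Prime) (e : Equiv.Perm α)
    (he : e ^ p = 1) {y : α} (hy : e y ≠ y) :
    Set.InjOn (fun i : ℕ => (e ^ i) y) (Finset.range p : Set ℕ) := by
  -- no power `e^d`, `0 < d < p`, fixes `y`
  have key : ∀ d, 0 < d → d < p → (e ^ d) y ≠ y := by
    intro d hd0 hdp hfix
    have hcop : Nat.Coprime d p := (Nat.coprime_of_lt_prime hd0.ne' hdp hp).symm
    obtain ⟨u, -, hu⟩ := Nat.exists_mul_mod_eq_one_of_coprime hcop hp.one_lt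
    have hfix' : ∀ n : ℕ, ((e ^ d) ^ n) y = y := fun n => by
      induction n with
      | zero => simp
      | succ n ih => rw [pow_succ, Equiv.Perm.mul_apply, hfix, ih]
    have h1 : e ^ (d * u) = e := by
      rw [← Nat.div_add_mod (d * u) p, hu, pow_add, pow_mul, he, one_pow, one_mul, pow_one]
    apply hy
    rw [← h1, pow_mul]
    exact hfix' u
  intro i hi j hj hij
  simp only [Finset.coe_range, Set.mem_Iio] at hi hj
  change (e ^ i) y = (e ^ j) y at hij
  by_contra hne
  wlog hlt : i < j generalizing i j
  · exact this hj hi hij.symm (Ne.symm hne) (lt_of_le_of_ne (not_lt.1 hlt) (Ne.symm hne))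
  refine key (j - i) (Nat.sub_pos_of_lt hlt) (lt_of_le_of_lt (Nat.sub_le j i) hj) ?_
  apply (e ^ i).injective
  rw [← Equiv.Perm.mul_apply, ← pow_add, Nat.add_sub_cancel' hlt.le]
  exact hij.symm

/-- **Orbit decomposition.** Let `e` be a permutation with `e^p = 1`, `p` prime, and `s` a finite
`e`-stable set without fixed points. Then `s` is a disjoint union of orbits of size `p`: there is a
transversal `R ⊆ s` with `∑_{y ∈ s} F(y) = ∑_{y ∈ R} ∑_{i < p} F(eⁱ y)` for every `F`. [folklore] -/
theorem exists_sum_eq_sum_sum_pow_apply {α M : Type*} [AddCommMonoid M] [DecidableEq α] {p : ℕ}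
    (hp : p.Prime) (e : Equiv.Perm α) (he : e ^ p = 1) (F : α → M) (s : Finset α)
    (hs : ∀ y ∈ s, e y ∈ s) (hs' : ∀ y ∈ s, e y ≠ y) :
    ∃ R : Finset α, R ⊆ s ∧ ∑ y ∈ s, F y = ∑ y ∈ R, ∑ i ∈ Finset.range p, F ((e ^ i) y) := by
  induction s using Finset.strongInduction with
  | H s ih =>
    rcases s.eq_empty_or_nonempty with rfl | ⟨y, hy⟩
    · exact ⟨∅, Finset.Subset.refl _, by simp⟩
    -- the orbit `O` of `y`
    have hmem : ∀ i : ℕ, (e ^ i) y ∈ s := fun i => by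
      induction i with
      | zero => simpa using hy
      | succ i ih' => rw [pow_succ', Equiv.Perm.mul_apply]; exact hs _ ih'
    obtain ⟨O, hO⟩ : ∃ O : Finset α, O = (Finset.range p).image fun i => (e ^ i) y := ⟨_, rfl⟩
    have hOs : O ⊆ s := fun z hz => by
      rw [hO] at hz
      obtain ⟨i, -, rfl⟩ := Finset.mem_image.1 hz
      exact hmem i
    have hyO : y ∈ O := hO ▸ Finset.mem_image.2 ⟨0, Finset.mem_range.2 hp.pos, by simp⟩
    have hinj : Set.InjOn (fun i : ℕ => (e ^ i) y) (Finset.range p : Set ℕ) :=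
      injOn_pow_apply_range hp e he (hs' y hy)
    -- `O` is `e`-stable, and so is its complement in `s`
    have hOe : ∀ z ∈ O, e z ∈ O := fun z hz => by
      rw [hO] at hz ⊢
      obtain ⟨i, hi, rfl⟩ := Finset.mem_image.1 hz
      rw [← Equiv.Perm.mul_apply, ← pow_succ']
      by_cases h : i + 1 < p
      · exact Finset.mem_image.2 ⟨i + 1, Finset.mem_range.2 h, rfl⟩
      · have hip : i + 1 = p := le_antisymm (Finset.mem_range.1 hi) (not_lt.1 h)
        rw [hip, he, Equiv.Perm.one_apply, ← hO]
        exact hyO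
    have hOe' : ∀ z, e z ∈ O → z ∈ O := fun z hz => by
      have himg : O.image e = O := Finset.eq_of_subset_of_card_le
        (Finset.image_subset_iff.2 hOe) (by rw [Finset.card_image_of_injective _ e.injective])
      rw [← himg] at hz
      obtain ⟨z', hz', hzz'⟩ := Finset.mem_image.1 hz
      rwa [← e.injective hzz']
    have hst : ∀ z ∈ s \ O, e z ∈ s \ O := fun z hz => by
      rw [Finset.mem_sdiff] at hz ⊢
      exact ⟨hs z hz.1, fun h => hz.2 (hOe' z h)⟩
    obtain ⟨R, hRs, hsum⟩ := ih (s \ O) (Finset.sdiff_ssubset hOs ⟨y, hyO⟩) hst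
      (fun z hz => hs' z (Finset.mem_sdiff.1 hz).1)
    have hyR : y ∉ R := fun h => (Finset.mem_sdiff.1 (hRs h)).2 hyO
    refine ⟨insert y R, Finset.insert_subset hy (hRs.trans Finset.sdiff_subset), ?_⟩
    rw [Finset.sum_insert hyR, ← Finset.sum_sdiff hOs, hsum, add_comm, hO,
      Finset.sum_image fun i hi j hj h => hinj hi hj h]

/-- In characteristic `p`, a function that is invariant under a permutation `e` of prime order
`p` sums to zero over any finite `e`-stable set without fixed points (each orbit contributes
`p · F(y) = 0`). This is why the Brauer map is multiplicative (Treumann–Venkatesh 2016, §4.2: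
"since the summands are invariant under `σ` and `k` has characteristic `p`"). [folklore] -/
theorem sum_eq_zero_of_perm_invariant {α M : Type*} [AddCommMonoid M] [DecidableEq α] {p : ℕ}
    (hp : p.Prime) (hM : ∀ m : M, p • m = 0) (e : Equiv.Perm α) (he : e ^ p = 1) (F : α → M)
    (hF : ∀ y, F (e y) = F y) (s : Finset α) (hs : ∀ y ∈ s, e y ∈ s) (hs' : ∀ y ∈ s, e y ≠ y) :
    ∑ y ∈ s, F y = 0 := by
  obtain ⟨R, -, hR⟩ := exists_sum_eq_sum_sum_pow_apply hp e he F s hs hs'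
  rw [hR]
  refine Finset.sum_eq_zero fun y _ => ?_
  have hi : ∀ i : ℕ, F ((e ^ i) y) = F y := fun i => by
    induction i with
    | zero => simp
    | succ i ih => rw [pow_succ', Equiv.Perm.mul_apply, hF, ih]
  simp only [hi, Finset.sum_const, Finset.card_range, hM]

end Orbits

/-! ### The cyclic norm `a ↦ a · a^σ ⋯ a^{σ^{p-1}}` (Tate cohomology of rings)

Treumann–Venkatesh 2016, §3.4: for a commutative `k`-algebra `A` with an automorphism `σ` of
order `p`, `a ↦ a a^σ ⋯ a^{σ^{p-1}}` is a ring homomorphism `A → Ĥ⁰(A) = A^σ/N A`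
(`N = 1 + σ + ⋯ + σ^{p-1}`), Frobenius-semilinear, restricting to the `p`-th power map on `A^σ`.
We record exactly the identities this amounts to. -/

section CyclicNorm

variable {A : Type*}

/-- The **cyclic norm** `N_{θ,p}(a) = a · θ(a) · θ²(a) ⋯ θ^{p-1}(a)` of an element `a` of a
`k`-algebra `A` with respect to an algebra automorphism `θ` (an ordered product; of interest when
`A` is commutative and `θ^p = 1`): the map `a ↦ a a^σ ⋯ a^{σ^{p-1}}` of Treumann–Venkatesh 2016,
§3.4, which induces the ring homomorphism `A → Ĥ⁰(A) = A^σ/NA` extending the `p`-th power map of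
`A^σ`. [cite: TreumannVenkatesh2016, §3.4] -/
def cyclicNorm [Semiring A] [Algebra k A] (θ : A ≃ₐ[k] A) (p : ℕ) (a : A) : A :=
  ((List.range p).map fun i => (θ ^ i) a).prod

/-- On a `θ`-fixed element the cyclic norm is the `p`-th power. [folklore] -/
theorem cyclicNorm_of_apply_eq [Semiring A] [Algebra k A] (θ : A ≃ₐ[k] A) (p : ℕ) {a : A}
    (ha : θ a = a) : cyclicNorm θ p a = a ^ p := by
  have h : ∀ i : ℕ, (θ ^ i) a = a := fun i => by
    induction i with
    | zero => rw [pow_zero, AlgEquiv.one_apply]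
    | succ i ih => rw [pow_succ, AlgEquiv.mul_apply, ha, ih]
  simp only [cyclicNorm, h, List.map_const', List.length_range, List.prod_replicate]

/-- The cyclic norm of `1` is `1`. [folklore] -/
theorem cyclicNorm_one [Semiring A] [Algebra k A] (θ : A ≃ₐ[k] A) (p : ℕ) :
    cyclicNorm θ p (1 : A) = 1 := by
  rw [cyclicNorm_of_apply_eq θ p (map_one θ), one_pow]

/-- In a commutative algebra the cyclic norm is the product `∏_{i<p} θⁱ(a)`. [folklore] -/
theorem cyclicNorm_eq_prod_range [CommSemiring A] [Algebra k A] (θ : A ≃ₐ[k] A) (p : ℕ) (a : A) :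
    cyclicNorm θ p a = ∏ i ∈ Finset.range p, (θ ^ i) a := by
  induction p with
  | zero => rfl
  | succ p ih =>
    rw [Finset.prod_range_succ, ← ih]
    exact List.prod_range_succ _ _

/-- In a commutative algebra the cyclic norm is the product `∏_{i : Fin p} θⁱ(a)`. [folklore] -/
theorem cyclicNorm_eq_prod_fin [CommSemiring A] [Algebra k A] (θ : A ≃ₐ[k] A) (p : ℕ) (a : A) :
    cyclicNorm θ p a = ∏ i : Fin p, (θ ^ (i : ℕ)) a := by
  rw [cyclicNorm_eq_prod_range, ← Fin.prod_univ_eq_prod_range]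

/-- The cyclic norm is multiplicative (commutative `A`). [folklore] -/
theorem cyclicNorm_mul [CommSemiring A] [Algebra k A] (θ : A ≃ₐ[k] A) (p : ℕ) (a b : A) :
    cyclicNorm θ p (a * b) = cyclicNorm θ p a * cyclicNorm θ p b := by
  simp only [cyclicNorm_eq_prod_range, map_mul, Finset.prod_mul_distrib]

/-- The cyclic norm is Frobenius-semilinear: `N(c • a) = c^p • N(a)` (commutative `A`). [folklore]
-/
theorem cyclicNorm_smul [CommSemiring A] [Algebra k A] (θ : A ≃ₐ[k] A) (p : ℕ) (c : k) (a : A) :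
    cyclicNorm θ p (c • a) = c ^ p • cyclicNorm θ p a := by
  rw [cyclicNorm_eq_prod_range, cyclicNorm_eq_prod_range]
  simp_rw [map_smul, Algebra.smul_def, map_pow]
  rw [Finset.prod_mul_distrib, Finset.prod_const, Finset.card_range]

/-- `θ (θⁱ a) = θ^{(i+1) mod p} a` when `θ^p = 1`, with the exponent read in `Fin p`. [folklore] -/
theorem apply_pow_fin_apply [Semiring A] [Algebra k A] (θ : A ≃ₐ[k] A) {p : ℕ} [NeZero p]
    (hp : p.Prime) (hθ : θ ^ p = 1) (i : Fin p) (a : A) :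
    θ ((θ ^ (i : ℕ)) a) = (θ ^ ((i + 1 : Fin p) : ℕ)) a := by
  rw [← AlgEquiv.mul_apply, ← pow_succ', Fin.val_add, Fin.val_one', Nat.mod_eq_of_lt hp.one_lt,
    ← pow_eq_pow_mod _ hθ]

/-- The cyclic norm is `θ`-invariant when `θ^p = 1` (commutative `A`): `θ(N a) = N a`, since `θ`
permutes the factors cyclically. [folklore] -/
theorem apply_cyclicNorm [CommSemiring A] [Algebra k A] (θ : A ≃ₐ[k] A) {p : ℕ} (hp : p.Prime)
    (hθ : θ ^ p = 1) (a : A) : θ (cyclicNorm θ p a) = cyclicNorm θ p a := by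
  haveI : NeZero p := ⟨hp.ne_zero⟩
  rw [cyclicNorm_eq_prod_fin, map_prod]
  simp_rw [apply_pow_fin_apply θ hp hθ]
  exact Fintype.prod_equiv (Equiv.addRight 1) _ _ fun i => rfl

open scoped Fin.NatCast in -- the coercion `ℕ → Fin p` (translations of `ℤ/p`) inside the proof
/-- **Additivity of the cyclic norm modulo traces** (Treumann–Venkatesh 2016, §3.4: the norm
`a ↦ a a^σ ⋯ a^{σ^{p-1}}` is a ring homomorphism into `Ĥ⁰(A) = A^σ/NA`): for `A` commutative,
`θ^p = 1` and `p` prime, `N(a + b) = N(a) + N(b) + ∑_{i<p} θⁱ(r)` for some `r ∈ A`. Proof: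
expanding `∏_{i ∈ ℤ/p} (θⁱ a + θⁱ b)` over subsets `t ⊆ ℤ/p`, translation `t ↦ t + 1` acts on the
terms through `θ`; its fixed points `t = ∅, ℤ/p` give `N(b), N(a)` and the free orbits (size `p`)
give traces. [cite: TreumannVenkatesh2016, §3.4] -/
theorem cyclicNorm_add [CommRing A] [Algebra k A] (θ : A ≃ₐ[k] A) {p : ℕ} (hp : p.Prime)
    (hθ : θ ^ p = 1) (a b : A) :
    ∃ r : A, cyclicNorm θ p (a + b) =
      cyclicNorm θ p a + cyclicNorm θ p b + ∑ i ∈ Finset.range p, (θ ^ i) r := by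
  classical
  haveI : NeZero p := ⟨hp.ne_zero⟩
  -- the terms of the expansion of `∏ᵢ (θⁱ a + θⁱ b)`, indexed by subsets `t ⊆ Fin p`
  obtain ⟨P, hP⟩ : ∃ P : Finset (Fin p) → A, P = fun t : Finset (Fin p) =>
      (∏ i ∈ t, (θ ^ (i : ℕ)) a) * ∏ i ∈ Finset.univ \ t, (θ ^ (i : ℕ)) b := ⟨_, rfl⟩
  -- translation by `1` on subsets of `Fin p`
  obtain ⟨E, hE⟩ : ∃ E : Equiv.Perm (Finset (Fin p)),
      E = (Equiv.addRight (1 : Fin p)).finsetCongr := ⟨_, rfl⟩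
  have hEt : ∀ t, E t = t.map (Equiv.addRight (1 : Fin p)).toEmbedding := fun t => by
    rw [hE, Equiv.finsetCongr_apply]
  -- (i) `θ` acts on the terms through `E`
  have hθP : ∀ t, θ (P t) = P (E t) := fun t => by
    rw [hP, hEt, map_mul, map_prod, map_prod]
    congr 1
    · rw [Finset.prod_map]
      exact Finset.prod_congr rfl fun i _ => apply_pow_fin_apply θ hp hθ i a
    · conv_rhs => rw [← Finset.map_univ_equiv (Equiv.addRight (1 : Fin p)), ← Finset.map_sdiff,
        Finset.prod_map]
      exact Finset.prod_congr rfl fun i _ => apply_pow_fin_apply θ hp hθ i b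
  have hθP' : ∀ (i : ℕ) (t : Finset (Fin p)), P ((E ^ i) t) = (θ ^ i) (P t) := fun i => by
    induction i with
    | zero => intro t; rw [pow_zero, pow_zero, Equiv.Perm.one_apply, AlgEquiv.one_apply]
    | succ i ih =>
      intro t
      rw [pow_succ', Equiv.Perm.mul_apply, ← hθP, ih, pow_succ', AlgEquiv.mul_apply]
  -- (ii) `E ^ p = 1`
  have hE1 : ∀ (n : ℕ) (x : Fin p), (Equiv.addRight (1 : Fin p) ^ n) x = x + (n : Fin p) :=
      fun n => by
    induction n with
    | zero => intro x; rw [pow_zero, Equiv.Perm.one_apply, Nat.cast_zero, add_zero]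
    | succ n ih =>
      intro x
      simp only [pow_succ', Equiv.Perm.mul_apply, ih, Equiv.coe_addRight, Nat.cast_succ, add_assoc]
  have hEp : E ^ p = 1 := by
    have hfc : ∀ n : ℕ, E ^ n = (Equiv.addRight (1 : Fin p) ^ n).finsetCongr := fun n => by
      induction n with
      | zero =>
        rw [pow_zero, pow_zero, Equiv.Perm.one_def, Equiv.Perm.one_def, Equiv.finsetCongr_refl]
      | succ n ih =>
        rw [pow_succ, ih, hE, Equiv.Perm.mul_def, Equiv.finsetCongr_trans, ← Equiv.Perm.mul_def,
          ← pow_succ]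
    have h1 : Equiv.addRight (1 : Fin p) ^ p = 1 :=
      Equiv.ext fun x => by rw [hE1, Fin.natCast_self, add_zero, Equiv.Perm.one_apply]
    rw [hfc, h1, Equiv.Perm.one_def, Equiv.finsetCongr_refl, Equiv.Perm.one_def]
  -- (iii) the subsets fixed by translation are `∅` and everything
  have hfix : ∀ t, E t = t → t = ∅ ∨ t = Finset.univ := fun t ht => by
    rcases t.eq_empty_or_nonempty with h | ⟨i, hi⟩
    · exact Or.inl h
    refine Or.inr (Finset.eq_univ_of_forall fun j => ?_)
    have hstep : ∀ x ∈ t, x + 1 ∈ t := fun x hx => by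
      rw [← ht, hEt]
      exact Finset.mem_map.2 ⟨x, hx, rfl⟩
    have hall : ∀ n : ℕ, i + (n : Fin p) ∈ t := fun n => by
      induction n with
      | zero => rw [Nat.cast_zero, add_zero]; exact hi
      | succ n ih => rw [Nat.cast_succ, ← add_assoc]; exact hstep _ ih
    have := hall ((j - i : Fin p) : ℕ)
    rwa [Fin.cast_val_eq_self, add_sub_cancel] at this
  -- (iv) expand and regroup
  have hexp : cyclicNorm θ p (a + b) = ∑ t, P t := by
    rw [cyclicNorm_eq_prod_fin]
    simp only [map_add]
    rw [Finset.prod_add, Finset.powerset_univ, hP]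
  have hsplit := Finset.sum_filter_add_sum_filter_not (Finset.univ : Finset (Finset (Fin p)))
    (fun t => E t = t) P
  have hfixsum : ∑ t ∈ Finset.univ.filter (fun t => E t = t), P t =
      cyclicNorm θ p a + cyclicNorm θ p b := by
    have hset : Finset.univ.filter (fun t => E t = t) = {Finset.univ, ∅} := by
      ext t
      simp only [Finset.mem_filter, Finset.mem_univ, true_and, Finset.mem_insert,
        Finset.mem_singleton]
      constructor
      · intro h
        exact (hfix t h).symm
      · rintro (rfl | rfl)
        · rw [hEt, Finset.map_univ_equiv]
        · rw [hEt, Finset.map_empty]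
    rw [hset, Finset.sum_pair Finset.univ_nonempty.ne_empty, cyclicNorm_eq_prod_fin,
      cyclicNorm_eq_prod_fin, hP]
    simp only [Finset.sdiff_self, Finset.sdiff_empty, Finset.prod_empty, mul_one, one_mul]
  have hfree : ∃ r, ∑ t ∈ Finset.univ.filter (fun t => ¬ E t = t), P t =
      ∑ i ∈ Finset.range p, (θ ^ i) r := by
    obtain ⟨R, -, hR⟩ := exists_sum_eq_sum_sum_pow_apply hp E hEp P
      (Finset.univ.filter fun t => ¬ E t = t)
      (fun t ht => by
        rw [Finset.mem_filter] at ht ⊢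
        exact ⟨Finset.mem_univ _, fun h => ht.2 (E.injective h)⟩)
      (fun t ht => (Finset.mem_filter.1 ht).2)
    refine ⟨∑ t ∈ R, P t, ?_⟩
    rw [hR, Finset.sum_comm]
    simp only [hθP', map_sum]
  obtain ⟨r, hr⟩ := hfree
  exact ⟨r, by rw [hexp, ← hsplit, hfixsum, hr]⟩

end CyclicNorm

/-! ### Fixed points of an automorphism of finite order; `σ`-plain subgroups -/

section Plain

/-- The subgroup `G^σ` of fixed points of an automorphism `σ` of a group `G`
(Treumann–Venkatesh 2016, §4.1). [folklore] -/
def fixedSubgroup (σ : G ≃* G) : Subgroup G :=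
  MonoidHom.eqLocus σ.toMonoidHom (MonoidHom.id G)

/-- Membership in `fixedSubgroup σ`. [folklore] -/
@[simp] theorem mem_fixedSubgroup {σ : G ≃* G} {g : G} : g ∈ fixedSubgroup σ ↔ σ g = g :=
  Iff.rfl

/-- `σ⁻¹` fixes the points fixed by `σ`. [folklore] -/
theorem symm_apply_eq_of_mem_fixedSubgroup {σ : G ≃* G} {g : G} (hg : g ∈ fixedSubgroup σ) :
    σ.symm g = g := by
  rw [mem_fixedSubgroup] at hg
  conv_lhs => rw [← hg]
  exact σ.symm_apply_apply g

/-- **Condition (a) of `σ`-plainness** (Treumann–Venkatesh 2016, §4.1 (a)): the injection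
`G^σ/K^σ ↪ (G/K)^σ`, `gK^σ ↦ gK`, is a bijection, i.e. every `σ`-fixed coset `gK` (`σ(g)K = gK`)
has a `σ`-fixed representative. (Injectivity is automatic:
`heckeAlgebra.quotientToQuotient_injective`;
only surjectivity is a condition.) This is the part of `σ`-plainness used by the Brauer
homomorphism; see `IsPlain` for the full notion. [cite: TreumannVenkatesh2016, §4.1] -/
def IsCosetPlain (K : Subgroup G) (σ : G ≃* G) : Prop :=
  ∀ g : G, ((σ g : G) : G ⧸ K) = (g : G ⧸ K) →
    ∃ h ∈ fixedSubgroup σ, ((h : G) : G ⧸ K) = (g : G ⧸ K)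

/-- **Condition (b) of `σ`-plainness**, "`K` is virtually prime-to-`p`" (Treumann–Venkatesh 2016,
§4.1 (b)): `K` has a finite-index subgroup `K'` which is a projective limit of finite groups of
order prime to `p`. In the setting of loc. cit. (`K` compact open in a locally profinite group `G`)
we read `K'` as an open subgroup of finite index (so `K'` is profinite, `K' = lim K'/N` over its
open normal subgroups) and the condition says: every open subgroup of `K'` has index prime to
`p`, i.e. `p ∤ [K' : U ∩ K']` for every open subgroup `U` of `G`; this is the form recorded here
(a literal transcription for a general topological group). It does not involve `σ` and plays no
role in the (normalized) Brauer homomorphism on Hecke algebras; it enters only the topological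
fixed-point arguments of loc. cit. §4.3. [cite: TreumannVenkatesh2016, §4.1] -/
def IsVirtuallyPrimeTo [TopologicalSpace G] (K : Subgroup G) (p : ℕ) : Prop :=
  ∃ K' : Subgroup G, K' ≤ K ∧ IsOpen (K' : Set G) ∧ K'.relIndex K ≠ 0 ∧
    ∀ U : Subgroup G, IsOpen (U : Set G) → ¬ p ∣ U.relIndex K'

/-- **`σ`-plain subgroups** (Treumann–Venkatesh 2016, §4.1): `K ≤ G` is `σ`-plain (for `σ` an
automorphism of `G` of prime order `p` with `σ(K) = K`) if (a) `G^σ/K^σ → (G/K)^σ` is a bijection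
(`IsCosetPlain`) and (b) `K` is virtually prime-to-`p` (`IsVirtuallyPrimeTo`).
[cite: TreumannVenkatesh2016, §4.1] -/
def IsPlain [TopologicalSpace G] (K : Subgroup G) (σ : G ≃* G) (p : ℕ) : Prop :=
  IsCosetPlain K σ ∧ IsVirtuallyPrimeTo K p

/-- A `σ`-plain subgroup satisfies condition (a). [folklore] -/
theorem IsPlain.isCosetPlain [TopologicalSpace G] {σ : G ≃* G} {p : ℕ} (h : IsPlain K σ p) :
    IsCosetPlain K σ :=
  h.1

/-- The trivial subgroup satisfies condition (a) for every `σ`: `(G/1)^σ = G^σ`. [folklore] -/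
theorem isCosetPlain_bot (σ : G ≃* G) : IsCosetPlain (⊥ : Subgroup G) σ := fun g hg =>
  ⟨g, by
    rw [QuotientGroup.eq, Subgroup.mem_bot, inv_mul_eq_one] at hg
    exact hg, rfl⟩

end Plain

namespace heckeAlgebra

/-! ### The Brauer homomorphism -/

section Brauer

variable (K) (σ : G ≃* G)

/-- **The Brauer homomorphism** `Br : ℋ(G, K) → ℋ(G^σ, K^σ)` of Treumann–Venkatesh 2016, §4.2,
"just given by restricting `h` from `G/K × G/K` to `(G^σ/K^σ) × (G^σ/K^σ)`": the restriction of
kernels (`restrict`) along `ι : G^σ/K^σ ↪ G/K`, `K^σ = K ∩ G^σ` (`kernel_brauerHom`). It is defined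
and `k`-linear on all of `ℋ(G, K)`; loc. cit. considers it on the `σ`-invariants `ℋ(G, K)^σ`
(`fixedSubalgebra`), where — for `K` `σ`-plain, `σ` of prime order `p = char k` — it is an algebra
homomorphism (`brauerHom_mul`, `brauerAlgHom`). It is `σ`-invariant (`brauerHom_congr`) and kills
traces `∑_{i<p} h^{σ^i}` (`brauerHom_sum_pow_congr`), i.e. factors through the Tate ring
`Ĥ⁰ = ℋ^σ/N ℋ` of loc. cit. §3.4. [cite: TreumannVenkatesh2016, §4.2] -/
abbrev brauerHom : heckeAlgebra k G K →ₗ[k]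
    heckeAlgebra k (fixedSubgroup σ) (K.subgroupOf (fixedSubgroup σ)) :=
  restrict K (fixedSubgroup σ)

/-- **Kernel of the Brauer homomorphism** = restriction of the kernel: for `x, y ∈ G^σ/K^σ`,
`kernel (Br T) x y = kernel T (ι x) (ι y)` (Treumann–Venkatesh 2016, §4.2).
[cite: TreumannVenkatesh2016, §4.2] -/
theorem kernel_brauerHom (T : heckeAlgebra k G K)
    (x y : fixedSubgroup σ ⧸ K.subgroupOf (fixedSubgroup σ)) :
    kernel (brauerHom K σ T) x y =
      kernel T (quotientToQuotient K (fixedSubgroup σ) x)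
        (quotientToQuotient K (fixedSubgroup σ) y) :=
  kernel_restrict K _ T x y

/-- The Brauer homomorphism is unital. [folklore] -/
theorem brauerHom_one : brauerHom K σ (1 : heckeAlgebra k G K) = 1 :=
  restrict_one K _

variable (hσ : ∀ x, σ x ∈ K ↔ x ∈ K)

/-- The permutation `σ̄ : gK ↦ σ(g)K` of `G ⧸ K` fixes the cosets of `σ`-fixed elements. [folklore]
-/
theorem quotientEquiv_quotientToQuotient (x : fixedSubgroup σ ⧸ K.subgroupOf (fixedSubgroup σ)) :
    quotientEquiv K K σ hσ (quotientToQuotient K (fixedSubgroup σ) x) =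
      quotientToQuotient K (fixedSubgroup σ) x := by
  induction x using QuotientGroup.induction_on with
  | H h => rw [quotientToQuotient_mk, quotientEquiv_mk, mem_fixedSubgroup.1 h.2]

/-- `σ̄⁻¹` fixes the cosets of `σ`-fixed elements. [folklore] -/
theorem quotientEquiv_symm_quotientToQuotient
    (x : fixedSubgroup σ ⧸ K.subgroupOf (fixedSubgroup σ)) :
    (quotientEquiv K K σ hσ).symm (quotientToQuotient K (fixedSubgroup σ) x) =
      quotientToQuotient K (fixedSubgroup σ) x := by
  rw [Equiv.symm_apply_eq, quotientEquiv_quotientToQuotient]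

variable {K σ} in
/-- Under condition (a) of plainness, every `σ̄`-fixed coset is in the image of
`ι : G^σ/K^σ → G/K`. [folklore] -/
theorem _root_.Literature.NumberTheory.Automorphic.IsCosetPlain.exists_eq_of_fixed
    (hK : IsCosetPlain K σ) {y : G ⧸ K}
    (hy : quotientEquiv K K σ hσ y = y) :
    ∃ x : fixedSubgroup σ ⧸ K.subgroupOf (fixedSubgroup σ),
      quotientToQuotient K (fixedSubgroup σ) x = y := by
  induction y using QuotientGroup.induction_on with
  | H g =>
    obtain ⟨h, hh, hhg⟩ := hK g hy
    exact ⟨((⟨h, hh⟩ : fixedSubgroup σ) : fixedSubgroup σ ⧸ K.subgroupOf (fixedSubgroup σ)), hhg⟩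

/-- Powers of `σ̄` are induced by powers of `σ`. [folklore] -/
theorem quotientEquiv_pow_mk (n : ℕ) (g : G) :
    (quotientEquiv K K σ hσ ^ n) (g : G ⧸ K) = (((σ ^ n) g : G) : G ⧸ K) := by
  induction n generalizing g with
  | zero => rw [pow_zero, pow_zero, Equiv.Perm.one_apply, MulAut.one_apply]
  | succ n ih =>
    rw [pow_succ, Equiv.Perm.mul_apply, quotientEquiv_mk, ih (σ g), pow_succ, MulAut.mul_apply]

/-- If `σ^p = 1` then `σ̄^p = 1` on `G ⧸ K`. [folklore] -/
theorem quotientEquiv_pow_eq_one {p : ℕ} (hσp : σ ^ p = 1) : quotientEquiv K K σ hσ ^ p = 1 := by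
  ext x
  induction x using QuotientGroup.induction_on with
  | H g => rw [quotientEquiv_pow_mk, hσp, MulAut.one_apply, Equiv.Perm.one_apply]

/-- A `σ`-invariant operator has a `σ̄`-invariant kernel: `kernel T (σ̄ x) (σ̄ y) = kernel T x y`
(Treumann–Venkatesh's `h^σ = h`). [folklore] -/
theorem kernel_quotientEquiv_of_congr_eq {T : heckeAlgebra k G K} (hT : congr K K σ hσ T = T)
    (x y : G ⧸ K) :
    kernel T (quotientEquiv K K σ hσ x) (quotientEquiv K K σ hσ y) = kernel T x y := by
  conv_lhs => rw [← hT]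
  exact kernel_congr_apply σ hσ T x y

/-- **`σ`-invariance of the Brauer map**: `Br(h^σ) = Br(h)` for every `h ∈ ℋ(G, K)` (the kernel
of `h^σ` at `σ`-fixed cosets is that of `h`). [folklore] -/
theorem brauerHom_congr (T : heckeAlgebra k G K) :
    brauerHom K σ (congr K K σ hσ T) = brauerHom K σ T := by
  refine ext_kernel' fun x y => ?_
  rw [kernel_brauerHom, kernel_brauerHom, kernel_congr, quotientEquiv_symm_quotientToQuotient,
    quotientEquiv_symm_quotientToQuotient]

/-- `Br(h^{σ^i}) = Br(h)`. [folklore] -/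
theorem brauerHom_pow_congr (n : ℕ) (T : heckeAlgebra k G K) :
    brauerHom K σ ((congr K K σ hσ ^ n) T) = brauerHom K σ T := by
  induction n with
  | zero => rw [pow_zero, AlgEquiv.one_apply]
  | succ n ih => rw [pow_succ', AlgEquiv.mul_apply, brauerHom_congr, ih]

/-- An automorphism acting on `G ⧸ K` like left translation by a fixed `t ∈ G`
(`σ(g)K = t·gK` for all `g`) acts trivially on `ℋ(G, K)`: kernels are `G`-invariant. [folklore] -/
theorem congr_eq_self_of_forall_mk_eq (t : G) (h : ∀ g : G, ((σ g : G) : G ⧸ K) = t • (g : G ⧸ K))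
    (T : heckeAlgebra k G K) : congr K K σ hσ T = T := by
  refine ext_kernel' fun x y => ?_
  have hx : ∀ z : G ⧸ K, (quotientEquiv K K σ hσ).symm z = t⁻¹ • z := fun z => by
    rw [Equiv.symm_apply_eq]
    induction z using QuotientGroup.induction_on with
    | H g =>
      rw [MulAction.Quotient.smul_coe, smul_eq_mul, quotientEquiv_mk, h,
        MulAction.Quotient.smul_coe, smul_eq_mul, mul_inv_cancel_left]
  rw [kernel_congr, hx, hx, kernel_smul_smul]

/-- **Inner automorphisms by elements of `K` act trivially on `ℋ(G, K)`**: for `t ∈ K` and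
`σ = Ad(t)`, `h^σ = h` for every `h` (so `ℋ(G, K)^σ = ℋ(G, K)`, the cyclic norm is `h^p` and
(4.3) reads `NBr(h)(x, y) = ((h^{∗p})(ι x, ι y))^{1/p}`). This is the situation of an inner
`σ = Ad(t)` with `t ∈ K_v`, e.g. at the `σ`-good places of Treumann–Venkatesh 2016, §5 for inner
`σ`. [folklore] -/
theorem congr_conj_eq_self {t : G} (ht : t ∈ K) (hσ' : ∀ x, MulAut.conj t x ∈ K ↔ x ∈ K)
    (T : heckeAlgebra k G K) : congr K K (MulAut.conj t) hσ' T = T := by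
  refine congr_eq_self_of_forall_mk_eq K (MulAut.conj t) hσ' t (fun g => ?_) T
  rw [MulAut.conj_apply, MulAction.Quotient.smul_coe, smul_eq_mul, QuotientGroup.mk_mul_of_mem _
    (K.inv_mem ht)]

/-- For `t ∈ K`, `Ad(t)` preserves `K` (the hypothesis `hσ` for `σ = Ad(t)`). [folklore] -/
theorem conj_mem_iff_of_mem {t : G} (ht : t ∈ K) (x : G) : MulAut.conj t x ∈ K ↔ x ∈ K := by
  rw [MulAut.conj_apply]
  constructor
  · intro h
    have h' := K.mul_mem (K.mul_mem (K.inv_mem ht) h) ht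
    rwa [← mul_assoc, ← mul_assoc, inv_mul_cancel, one_mul, mul_assoc, inv_mul_cancel,
      mul_one] at h'
  · intro h
    exact K.mul_mem (K.mul_mem ht h) (K.inv_mem ht)

/-- Change of coefficients commutes with transport of structure (both act on kernels, one on
values, the other on arguments). [folklore] -/
theorem mapCoeffs_congr {G' : Type*} [Group G'] (K' : Subgroup G') (e : G ≃* G')
    (he : ∀ x, e x ∈ K' ↔ x ∈ K) (τ : k ≃+* k) (T : heckeAlgebra k G K) :
    mapCoeffs K' τ (congr K K' e he T) = congr K K' e he (mapCoeffs K τ T) := by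
  refine ext_kernel' fun x y => ?_
  rw [kernel_mapCoeffs, kernel_congr, kernel_congr, kernel_mapCoeffs]

/-- Change of coefficients commutes with the Brauer map. [folklore] -/
theorem brauerHom_mapCoeffs (τ : k ≃+* k) (T : heckeAlgebra k G K) :
    brauerHom K σ (mapCoeffs K τ T) =
      mapCoeffs (K.subgroupOf (fixedSubgroup σ)) τ (brauerHom K σ T) := by
  refine ext_kernel' fun x y => ?_
  rw [kernel_brauerHom, kernel_mapCoeffs, kernel_mapCoeffs, kernel_brauerHom]

/-- **The Brauer map kills traces**: `Br(∑_{i<p} h^{σ^i}) = p · Br(h) = 0` in characteristic `p`;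
thus `Br` factors through the Tate ring `Ĥ⁰(ℋ(G, K)) = ℋ^σ / N·ℋ` of Treumann–Venkatesh 2016,
§3.4 and §4.2. [cite: TreumannVenkatesh2016, §3.4] -/
theorem brauerHom_sum_pow_congr (p : ℕ) [CharP k p] (T : heckeAlgebra k G K) :
    brauerHom K σ (∑ i ∈ Finset.range p, (congr K K σ hσ ^ i) T) = 0 := by
  rw [map_sum]
  simp only [brauerHom_pow_congr, Finset.sum_const, Finset.card_range]
  rw [← Nat.cast_smul_eq_nsmul k, CharP.cast_eq_zero, zero_smul]

/-- **The Brauer map is multiplicative on `σ`-invariants** (Treumann–Venkatesh 2016, §4.2: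
"Since the summands of (heckemult) are invariant under the action of `σ` on `G/K`, and `k` has
characteristic `p`, the Brauer map is an algebra homomorphism"). Precisely: if `σ^p = 1` with
`p = char k` prime, `K` satisfies condition (a) of `σ`-plainness and `S, T ∈ ℋ(G, K)^σ`, then
`Br(S T) = Br(S) Br(T)`. Proof: in `kernel (S T) (ι x) (ι z) = ∑_{y ∈ G/K} kernel S (ι x) y ·
kernel T y (ι z)` the summand is `σ̄`-invariant, the `σ̄`-fixed `y` are exactly the `ι y'`
(plainness) and give `kernel (Br S · Br T) x z`, and the free `σ̄`-orbits have size `p` and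
contribute `0` (`sum_eq_zero_of_perm_invariant`). [cite: TreumannVenkatesh2016, §4.2] -/
theorem brauerHom_mul {p : ℕ} [hp : Fact p.Prime] [CharP k p] (hσp : σ ^ p = 1)
    (hK : IsCosetPlain K σ) {S T : heckeAlgebra k G K} (hS : congr K K σ hσ S = S)
    (hT : congr K K σ hσ T = T) :
    brauerHom K σ (S * T) = brauerHom K σ S * brauerHom K σ T := by
  classical
  refine ext_kernel' fun x' z' => ?_
  rw [kernel_brauerHom, kernel_mul, kernel_mul]
  simp only [kernel_brauerHom]
  -- the summand `F` and its `σ̄`-invariance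
  set F : G ⧸ K → k := fun y =>
    kernel S (quotientToQuotient K (fixedSubgroup σ) x') y *
      kernel T y (quotientToQuotient K (fixedSubgroup σ) z') with hF
  have hFe : ∀ y, F (quotientEquiv K K σ hσ y) = F y := fun y => by
    simp only [hF]
    conv_lhs => rw [← quotientEquiv_quotientToQuotient K σ hσ x',
      ← quotientEquiv_quotientToQuotient K σ hσ z', kernel_quotientEquiv_of_congr_eq K σ hσ hS,
      kernel_quotientEquiv_of_congr_eq K σ hσ hT]
  have hfin : (Function.support F).Finite :=
    (finite_support_kernel T _).subset (Function.support_mul_subset_right _ _)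
  change ∑ᶠ y, F y = ∑ᶠ y', F (quotientToQuotient K (fixedSubgroup σ) y')
  rw [finsum_eq_sum_of_support_subset F (s := hfin.toFinset) (by simp),
    ← Finset.sum_filter_add_sum_filter_not hfin.toFinset (fun y => quotientEquiv K K σ hσ y = y) F]
  -- the free orbits contribute zero
  have hvan : ∑ y ∈ hfin.toFinset.filter (fun y => ¬ quotientEquiv K K σ hσ y = y), F y = 0 := by
    refine sum_eq_zero_of_perm_invariant hp.out (fun m => ?_) (quotientEquiv K K σ hσ)
      (quotientEquiv_pow_eq_one K σ hσ hσp) F hFe _ (fun y hy => ?_) (fun y hy => ?_)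
    · rw [← Nat.cast_smul_eq_nsmul k, CharP.cast_eq_zero, zero_smul]
    · rw [Finset.mem_filter, Set.Finite.mem_toFinset, Function.mem_support] at hy ⊢
      exact ⟨by rw [hFe]; exact hy.1, fun h => hy.2 ((quotientEquiv K K σ hσ).injective h)⟩
    · exact (Finset.mem_filter.1 hy).2
  rw [hvan, add_zero]
  -- the fixed cosets are the image of `ι` (plainness)
  have hsupp : (Function.support fun y' => F (quotientToQuotient K (fixedSubgroup σ) y')) ⊆
      ↑((hfin.toFinset.filter fun y => quotientEquiv K K σ hσ y = y).preimage
        (quotientToQuotient K (fixedSubgroup σ)) (quotientToQuotient_injective K _).injOn) := by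
    intro y' hy'
    rw [Finset.coe_preimage, Set.mem_preimage, Finset.mem_coe, Finset.mem_filter,
      Set.Finite.mem_toFinset]
    exact ⟨hy', quotientEquiv_quotientToQuotient K σ hσ y'⟩
  rw [finsum_eq_sum_of_support_subset _ hsupp, Finset.sum_preimage _ _ _ F]
  rintro y hy hy'
  exact (hy' (hK.exists_eq_of_fixed hσ (Finset.mem_filter.1 hy).2)).elim

/-- The subalgebra `ℋ(G, K)^σ` of `σ`-invariant Hecke operators (Treumann–Venkatesh 2016, §4.2).
[cite: TreumannVenkatesh2016, §4.2] -/
def fixedSubalgebra : Subalgebra k (heckeAlgebra k G K) :=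
  AlgHom.equalizer (congr K K σ hσ).toAlgHom (AlgHom.id k _)

/-- Membership in `fixedSubalgebra`: `h^σ = h`. [folklore] -/
theorem mem_fixedSubalgebra {T : heckeAlgebra k G K} :
    T ∈ fixedSubalgebra K σ hσ ↔ congr K K σ hσ T = T :=
  Iff.rfl

/-- **The Brauer homomorphism as a `k`-algebra homomorphism** `ℋ(G, K)^σ →ₐ[k] ℋ(G^σ, K^σ)` for
`σ` of prime order `p = char k` and `K` satisfying condition (a) of `σ`-plainness
(Treumann–Venkatesh 2016, §4.2). [cite: TreumannVenkatesh2016, §4.2] -/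
def brauerAlgHom (p : ℕ) [Fact p.Prime] [CharP k p] (hσp : σ ^ p = 1) (hK : IsCosetPlain K σ) :
    fixedSubalgebra (k := k) K σ hσ →ₐ[k]
      heckeAlgebra k (fixedSubgroup σ) (K.subgroupOf (fixedSubgroup σ)) :=
  AlgHom.ofLinearMap ((brauerHom K σ).comp (fixedSubalgebra K σ hσ).val.toLinearMap)
    (brauerHom_one K σ) fun S T => brauerHom_mul K σ hσ hσp hK S.2 T.2

/-- `brauerAlgHom` is `brauerHom` on `ℋ(G, K)^σ`. [folklore] -/
theorem brauerAlgHom_apply (p : ℕ) [Fact p.Prime] [CharP k p] (hσp : σ ^ p = 1)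
    (hK : IsCosetPlain K σ) (T : fixedSubalgebra (k := k) K σ hσ) :
    brauerAlgHom K σ hσ p hσp hK T = brauerHom K σ (T : heckeAlgebra k G K) :=
  rfl

end Brauer

/-! ### The normalized Brauer homomorphism -/

section Normalized

variable (K) (σ : G ≃* G) (hσ : ∀ x, σ x ∈ K ↔ x ∈ K) (p : ℕ)

/-- **The Frobenius-semilinear Brauer homomorphism** `B̃r : ℋ(G, K) → ℋ(G^σ, K^σ)` of
Treumann–Venkatesh 2016, §4.3 ("the `p`th power of `Br` extends uniquely to a homomorphism `B̃r`",
by §3.4 applied to the Tate ring of `ℋ(G, K)`): `B̃r(h) = Br(h · h^σ ⋯ h^{σ^{p-1}})`, the Brauer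
map of the cyclic norm. Defined for every `h`; when `ℋ(G, K)` is commutative, `σ^p = 1`,
`p = char k` and `K` is `σ`-plain it is a ring homomorphism, Frobenius-semilinear
(`frobeniusBrauerHom_add`, `_mul`, `_smul`), equal to `h ↦ Br(h)^p` on `ℋ(G, K)^σ`
(`frobeniusBrauerHom_of_congr_eq`). [cite: TreumannVenkatesh2016, §4.3] -/
def frobeniusBrauerHom (T : heckeAlgebra k G K) :
    heckeAlgebra k (fixedSubgroup σ) (K.subgroupOf (fixedSubgroup σ)) :=
  brauerHom K σ (cyclicNorm (congr K K σ hσ) p T)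

/-- **The normalized Brauer homomorphism** `NBr : ℋ(G, K) → ℋ(G^σ, K^σ)` of Treumann–Venkatesh
2016, §4.3: "the unique `k`-linear homomorphism that agrees with `B̃r` on
`Fun_G(G/K × G/K; 𝔽_p)`", i.e. `B̃r = Br ∘ N_σ` followed by the inverse Frobenius `id ⊗ Frob⁻¹` of
the `𝔽_p`-structure `ℋ = Fun_G(…; 𝔽_p) ⊗ k` (entrywise `p`-th roots of kernels, `mapCoeffs`), for a
perfect `k` of characteristic `p`. Explicitly (`kernel_normalizedBrauerHom`)

  `NBr(h)(x, y) = ((h · h^σ ⋯ h^{σ^{p-1}})(ι x, ι y))^{1/p}`,  `x, y ∈ G^σ/K^σ`,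

which for `σ`-invariant `h` is the printed formula (4.3) of loc. cit.,
`NBr(h)(K^σ, gK^σ) = ((h^{∗p})(K, gK))^{1/p}` (`kernel_normalizedBrauerHom_of_congr_eq`). (As
printed, (4.3) is asserted for all `h`; it agrees with the defining characterisation only on
`ℋ(G, K)^σ` — e.g. for `G = ℤ`, `K = 1`, `σ = -1`, `p = 2`, `h = [1]` the definition gives the
augmentation `NBr(h) = 1` while `((h ∗ h)(0, 0))^{1/2} = 0` — so we follow the characterisation.)
It is defined for every `h`; it is a `k`-algebra homomorphism (`normalizedBrauerAlgHom`) when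
`ℋ(G, K)` is commutative (`IsGelfandPair`), `σ^p = 1` and `K` satisfies condition (a) of
`σ`-plainness — loc. cit. assumes moreover that both Hecke algebras are integral domains, which is
needed only for the uniqueness assertion, not for the construction.
[cite: TreumannVenkatesh2016, §4.3 eq. (4.3)] -/
def normalizedBrauerHom [Fact p.Prime] [CharP k p] [PerfectRing k p] (T : heckeAlgebra k G K) :
    heckeAlgebra k (fixedSubgroup σ) (K.subgroupOf (fixedSubgroup σ)) :=
  mapCoeffs (K.subgroupOf (fixedSubgroup σ)) (frobeniusEquiv k p).symm
    (frobeniusBrauerHom K σ hσ p T)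

/-- **Kernel of `B̃r`**: the restriction of the kernel of the cyclic norm `h h^σ ⋯ h^{σ^{p-1}}`.
[folklore] -/
theorem kernel_frobeniusBrauerHom (T : heckeAlgebra k G K)
    (x y : fixedSubgroup σ ⧸ K.subgroupOf (fixedSubgroup σ)) :
    kernel (frobeniusBrauerHom K σ hσ p T) x y =
      kernel (cyclicNorm (congr K K σ hσ) p T) (quotientToQuotient K (fixedSubgroup σ) x)
        (quotientToQuotient K (fixedSubgroup σ) y) :=
  kernel_brauerHom K σ _ x y

/-- On `σ`-invariant `h`, `B̃r(h) = Br(h^p)` (`= Br(h)^p` when `Br` is multiplicative).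
[folklore] -/
theorem frobeniusBrauerHom_of_congr_eq {T : heckeAlgebra k G K} (hT : congr K K σ hσ T = T) :
    frobeniusBrauerHom K σ hσ p T = brauerHom K σ (T ^ p) := by
  rw [frobeniusBrauerHom, cyclicNorm_of_apply_eq _ p hT]

/-- **Explicit formula for the normalized Brauer homomorphism**: for `x, y ∈ G^σ/K^σ`,
`kernel (NBr h) x y = Frob⁻¹ (kernel (h h^σ ⋯ h^{σ^{p-1}}) (ι x) (ι y))`, the general form of
Treumann–Venkatesh 2016, eq. (4.3) (see the module docstring).
[cite: TreumannVenkatesh2016, §4.3 eq. (4.3)] -/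
theorem kernel_normalizedBrauerHom [Fact p.Prime] [CharP k p] [PerfectRing k p]
    (T : heckeAlgebra k G K) (x y : fixedSubgroup σ ⧸ K.subgroupOf (fixedSubgroup σ)) :
    kernel (normalizedBrauerHom K σ hσ p T) x y =
      (frobeniusEquiv k p).symm (kernel (cyclicNorm (congr K K σ hσ) p T)
        (quotientToQuotient K (fixedSubgroup σ) x) (quotientToQuotient K (fixedSubgroup σ) y)) := by
  rw [normalizedBrauerHom, kernel_mapCoeffs, kernel_frobeniusBrauerHom]

/-- The `p`-th power of a kernel entry of `NBr h` is the corresponding entry of the cyclic norm of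
`h`. [folklore] -/
theorem kernel_normalizedBrauerHom_pow [Fact p.Prime] [CharP k p] [PerfectRing k p]
    (T : heckeAlgebra k G K) (x y : fixedSubgroup σ ⧸ K.subgroupOf (fixedSubgroup σ)) :
    kernel (normalizedBrauerHom K σ hσ p T) x y ^ p =
      kernel (cyclicNorm (congr K K σ hσ) p T)
        (quotientToQuotient K (fixedSubgroup σ) x) (quotientToQuotient K (fixedSubgroup σ) y) := by
  rw [kernel_normalizedBrauerHom, frobeniusEquiv_symm_pow_p]

/-- **Treumann–Venkatesh's formula (4.3)** for `σ`-invariant `h`: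
`NBr(h)(K^σ x, K^σ y) = ((h^{∗p})(K ι x, K ι y))^{1/p}`. [cite: TreumannVenkatesh2016, §4.3 eq.
(4.3)] -/
theorem kernel_normalizedBrauerHom_of_congr_eq [Fact p.Prime] [CharP k p] [PerfectRing k p]
    {T : heckeAlgebra k G K} (hT : congr K K σ hσ T = T)
    (x y : fixedSubgroup σ ⧸ K.subgroupOf (fixedSubgroup σ)) :
    kernel (normalizedBrauerHom K σ hσ p T) x y =
      (frobeniusEquiv k p).symm (kernel (T ^ p)
        (quotientToQuotient K (fixedSubgroup σ) x) (quotientToQuotient K (fixedSubgroup σ) y)) := by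
  rw [kernel_normalizedBrauerHom, cyclicNorm_of_apply_eq _ p hT]

/-- `NBr(1) = 1`. [folklore] -/
theorem normalizedBrauerHom_one [Fact p.Prime] [CharP k p] [PerfectRing k p] :
    normalizedBrauerHom K σ hσ p (1 : heckeAlgebra k G K) = 1 := by
  rw [normalizedBrauerHom, frobeniusBrauerHom, cyclicNorm_one, brauerHom_one, map_one]

/-- Change of coefficients commutes with the cyclic norm of the `σ`-action. [folklore] -/
theorem mapCoeffs_cyclicNorm_congr (τ : k ≃+* k) (T : heckeAlgebra k G K) :
    mapCoeffs K τ (cyclicNorm (congr K K σ hσ) p T) =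
      cyclicNorm (congr K K σ hσ) p (mapCoeffs K τ T) := by
  have hpow : ∀ (i : ℕ) (S : heckeAlgebra k G K),
      mapCoeffs K τ ((congr K K σ hσ ^ i) S) = (congr K K σ hσ ^ i) (mapCoeffs K τ S) := fun i => by
    induction i with
    | zero => intro S; rw [pow_zero, AlgEquiv.one_apply, AlgEquiv.one_apply]
    | succ i ih =>
      intro S
      rw [pow_succ', AlgEquiv.mul_apply, AlgEquiv.mul_apply, mapCoeffs_congr, ih]
  rw [cyclicNorm, cyclicNorm, map_list_prod, List.map_map]
  congr 1
  exact List.map_congr_left fun i _ => hpow i T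

/-- `B̃r` commutes with change of coefficients (`τ` a ring automorphism of `k`, e.g. Frobenius of a
perfect `k`): `B̃r` is defined over the prime field. [folklore] -/
theorem frobeniusBrauerHom_mapCoeffs (τ : k ≃+* k) (T : heckeAlgebra k G K) :
    frobeniusBrauerHom K σ hσ p (mapCoeffs K τ T) =
      mapCoeffs (K.subgroupOf (fixedSubgroup σ)) τ (frobeniusBrauerHom K σ hσ p T) := by
  rw [frobeniusBrauerHom, frobeniusBrauerHom, ← mapCoeffs_cyclicNorm_congr, brauerHom_mapCoeffs]

/-- **`NBr` agrees with `B̃r` on `𝔽_p`-valued functions** — the defining property of the normalized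
Brauer homomorphism in Treumann–Venkatesh 2016, §4.3 ("the unique `k`-linear homomorphism that
agrees with `B̃r` on `Fun_G(G/K × G/K; 𝔽_p)`"): if the kernel of `h` is fixed by Frobenius
(for a field `k`: takes values in the prime field `𝔽_p`), i.e. `h` is fixed by
`mapCoeffs Frob`, then `NBr(h) = B̃r(h)`. [cite: TreumannVenkatesh2016, §4.3] -/
theorem normalizedBrauerHom_of_mapCoeffs_frobenius_eq [Fact p.Prime] [CharP k p] [PerfectRing k p]
    {T : heckeAlgebra k G K} (hT : mapCoeffs K (frobeniusEquiv k p) T = T) :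
    normalizedBrauerHom K σ hσ p T = frobeniusBrauerHom K σ hσ p T := by
  rw [normalizedBrauerHom]
  conv_lhs =>
    rw [← hT, frobeniusBrauerHom_mapCoeffs, ← mapCoeffs_symm_apply, RingEquiv.symm_apply_apply]

variable {K σ hσ p}

/-- The commutative ring structure on the Hecke algebra of a Gelfand pair (the `Ring` structure of
`ℋ(G, K)` together with the commutativity `IsGelfandPair k G K`); used as a local instance.
[folklore] -/
abbrev _root_.Literature.NumberTheory.Automorphic.IsGelfandPair.commRing
    (hc : IsGelfandPair k G K) :
    CommRing (heckeAlgebra k G K) :=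
  { (inferInstance : Ring (heckeAlgebra k G K)) with mul_comm := hc }

/-- The powers of the `σ`-action die with `σ`: `σ^p = 1` implies `(h ↦ h^σ)^p = 1`. [folklore] -/
theorem congr_pow_eq_one {p : ℕ} (hσp : σ ^ p = 1) : congr (k := k) K K σ hσ ^ p = 1 := by
  refine AlgEquiv.ext fun T => ext_kernel' fun x y => ?_
  rw [AlgEquiv.one_apply]
  have key : ∀ (n : ℕ) (x y : G ⧸ K), kernel ((congr K K σ hσ ^ n) T)
      ((quotientEquiv K K σ hσ ^ n) x) ((quotientEquiv K K σ hσ ^ n) y) = kernel T x y := by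
    intro n
    induction n with
    | zero => intro x y; rw [pow_zero, pow_zero, AlgEquiv.one_apply, Equiv.Perm.one_apply,
        Equiv.Perm.one_apply]
    | succ n ih =>
      intro x y
      rw [pow_succ', AlgEquiv.mul_apply, pow_succ', Equiv.Perm.mul_apply, Equiv.Perm.mul_apply,
        kernel_congr_apply, ih]
  have h := key p x y
  rwa [quotientEquiv_pow_eq_one K σ hσ hσp, Equiv.Perm.one_apply, Equiv.Perm.one_apply] at h

variable (K σ hσ p)

/-- The cyclic norm of a Hecke operator is `σ`-invariant (commutative `ℋ(G, K)`, `σ^p = 1`).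
[folklore] -/
theorem congr_cyclicNorm (hc : IsGelfandPair k G K) (hp : p.Prime) (hσp : σ ^ p = 1)
    (T : heckeAlgebra k G K) :
    congr K K σ hσ (cyclicNorm (congr K K σ hσ) p T) = cyclicNorm (congr K K σ hσ) p T := by
  letI := hc.commRing
  exact apply_cyclicNorm (congr K K σ hσ) hp (congr_pow_eq_one hσp) T

/-- **`B̃r` is additive** (commutative `ℋ(G, K)`, `σ^p = 1`, `p = char k`): the cyclic norm is
additive modulo traces `∑ h^{σ^i}`, which `Br` kills (Treumann–Venkatesh 2016, §3.4, §4.3).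
[cite: TreumannVenkatesh2016, §4.3] -/
theorem frobeniusBrauerHom_add [Fact p.Prime] [CharP k p] (hc : IsGelfandPair k G K)
    (hσp : σ ^ p = 1) (S T : heckeAlgebra k G K) :
    frobeniusBrauerHom K σ hσ p (S + T) =
      frobeniusBrauerHom K σ hσ p S + frobeniusBrauerHom K σ hσ p T := by
  letI := hc.commRing
  obtain ⟨r, hr⟩ := cyclicNorm_add (congr K K σ hσ) (Fact.out : p.Prime) (congr_pow_eq_one hσp) S T
  rw [frobeniusBrauerHom, hr, map_add, map_add, brauerHom_sum_pow_congr, add_zero]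
  rfl

/-- **`B̃r` is Frobenius-semilinear**: `B̃r(c h) = c^p B̃r(h)` (commutative `ℋ(G, K)`).
[folklore] -/
theorem frobeniusBrauerHom_smul (hc : IsGelfandPair k G K) (c : k) (T : heckeAlgebra k G K) :
    frobeniusBrauerHom K σ hσ p (c • T) = c ^ p • frobeniusBrauerHom K σ hσ p T := by
  letI := hc.commRing
  rw [frobeniusBrauerHom, cyclicNorm_smul, map_smul]
  rfl

/-- **`B̃r` is multiplicative** (commutative `ℋ(G, K)`, `σ^p = 1`, `p = char k`, `K` satisfying
condition (a) of `σ`-plainness): the cyclic norm is multiplicative with `σ`-invariant values, on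
which `Br` is multiplicative (Treumann–Venkatesh 2016, §4.3). [cite: TreumannVenkatesh2016, §4.3] -/
theorem frobeniusBrauerHom_mul [Fact p.Prime] [CharP k p] (hc : IsGelfandPair k G K)
    (hσp : σ ^ p = 1) (hK : IsCosetPlain K σ) (S T : heckeAlgebra k G K) :
    frobeniusBrauerHom K σ hσ p (S * T) =
      frobeniusBrauerHom K σ hσ p S * frobeniusBrauerHom K σ hσ p T := by
  letI := hc.commRing
  have hp : p.Prime := Fact.out
  rw [frobeniusBrauerHom, cyclicNorm_mul, brauerHom_mul K σ hσ hσp hK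
    (congr_cyclicNorm K σ hσ p hc hp hσp S) (congr_cyclicNorm K σ hσ p hc hp hσp T)]
  rfl

/-- `NBr` is additive (hypotheses as in `frobeniusBrauerHom_add`). [folklore] -/
theorem normalizedBrauerHom_add [Fact p.Prime] [CharP k p] [PerfectRing k p]
    (hc : IsGelfandPair k G K) (hσp : σ ^ p = 1) (S T : heckeAlgebra k G K) :
    normalizedBrauerHom K σ hσ p (S + T) =
      normalizedBrauerHom K σ hσ p S + normalizedBrauerHom K σ hσ p T := by
  rw [normalizedBrauerHom, frobeniusBrauerHom_add K σ hσ p hc hσp, map_add]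
  rfl

/-- **`NBr` is `k`-linear**: the inverse Frobenius untwists the semilinearity of `B̃r`
(Treumann–Venkatesh 2016, §4.3). [cite: TreumannVenkatesh2016, §4.3] -/
theorem normalizedBrauerHom_smul [Fact p.Prime] [CharP k p] [PerfectRing k p]
    (hc : IsGelfandPair k G K) (c : k) (T : heckeAlgebra k G K) :
    normalizedBrauerHom K σ hσ p (c • T) = c • normalizedBrauerHom K σ hσ p T := by
  rw [normalizedBrauerHom, frobeniusBrauerHom_smul K σ hσ p hc, mapCoeffs_smul,
    frobeniusEquiv_symm_pow]
  rfl

/-- `NBr` is multiplicative (hypotheses as in `frobeniusBrauerHom_mul`). [folklore] -/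
theorem normalizedBrauerHom_mul [Fact p.Prime] [CharP k p] [PerfectRing k p]
    (hc : IsGelfandPair k G K) (hσp : σ ^ p = 1) (hK : IsCosetPlain K σ)
    (S T : heckeAlgebra k G K) :
    normalizedBrauerHom K σ hσ p (S * T) =
      normalizedBrauerHom K σ hσ p S * normalizedBrauerHom K σ hσ p T := by
  rw [normalizedBrauerHom, frobeniusBrauerHom_mul K σ hσ p hc hσp hK, map_mul]
  rfl

/-- **The normalized Brauer homomorphism as a `k`-algebra homomorphism**
`NBr : ℋ(G, K) →ₐ[k] ℋ(G^σ, K^σ)` (Treumann–Venkatesh 2016, §4.3), for `k` perfect of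
characteristic `p`, `σ` of order `p` with `σ(K) = K`, `K` satisfying condition (a) of
`σ`-plainness and `ℋ(G, K)` commutative. [cite: TreumannVenkatesh2016, §4.3] -/
def normalizedBrauerAlgHom [Fact p.Prime] [CharP k p] [PerfectRing k p]
    (hc : IsGelfandPair k G K) (hσp : σ ^ p = 1) (hK : IsCosetPlain K σ) :
    heckeAlgebra k G K →ₐ[k] heckeAlgebra k (fixedSubgroup σ) (K.subgroupOf (fixedSubgroup σ)) :=
  AlgHom.ofLinearMap
    { toFun := normalizedBrauerHom K σ hσ p
      map_add' := normalizedBrauerHom_add K σ hσ p hc hσp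
      map_smul' := normalizedBrauerHom_smul K σ hσ p hc }
    (normalizedBrauerHom_one K σ hσ p) (normalizedBrauerHom_mul K σ hσ p hc hσp hK)

/-- `normalizedBrauerAlgHom` is `normalizedBrauerHom` as a function. [folklore] -/
theorem normalizedBrauerAlgHom_apply [Fact p.Prime] [CharP k p] [PerfectRing k p]
    (hc : IsGelfandPair k G K) (hσp : σ ^ p = 1) (hK : IsCosetPlain K σ) (T : heckeAlgebra k G K) :
    normalizedBrauerAlgHom K σ hσ p hc hσp hK T = normalizedBrauerHom K σ hσ p T :=
  rfl

end Normalized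

end heckeAlgebra

end Literature.NumberTheory.Automorphic

end
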